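import Summits.NavierStokesRegularity.NavierStokesRegularity.Theses.RellichScar
import Literature.Analysis.FluidPDE.UniformDriftBackwardNonuniqueness
import Literature.Analysis.FluidPDE.PotentialFlowParabolicExterior
import Literature.Analysis.FluidPDE.DipoleMomentFlowParabolicExterior
import Literature.Analysis.FluidPDE.ParasiticSlabFlow
import Literature.Analysis.FluidPDE.KinematicApexWitness
import Literature.Analysis.FluidPDE.RadialCalculus
import Literature.Analysis.FluidPDE.CaloricRemainderCalculus
import Literature.Analysis.FluidPDE.SpaceTimeMollifier
import Literature.Analysis.FluidPDE.HessianLaplacian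
import Literature.Analysis.FluidPDE.LeraySelfSimilarCalculus
import HarnessLib

/-!
# Disproof of `ScarRigidity` — findings (cdisprove, crux `stmt-NavierStokesRegularity-11717`, route RellichScar)

Standing adversary's work file, cycle 4 (gen 4; §0–§7 of cycles 1–3 kept verbatim; §8–§10 NEW in cycle 4 —
read §8 first: the small-constant slices of the crux, including the whole `2C² < 1` regime of the picked line's
threshold stub, are VACUOUS up to `C ≈ 1.16`).  Cycle 1's v1–v5 (89 KB, evidence
`20260815T233217Z-Disproof.lean`, not mounted on this hub) is RE-FOUNDED here compactly on the five
Literature files it landed (`DipolePotentialFlow` p68870, `UniformDriftBackwardNonuniqueness` p68990,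
`PotentialFlowParabolicExterior` p69383, `SerrinPotentialFlow` p70140,
`DipoleMomentFlowParabolicExterior` p70235) and on the sibling disprover's `ParasiticSlabFlow` /
`KinematicApexWitness`, and EXTENDED (§2 (A⁺), (B⁺)).  Everything outside docstrings is checked Lean;
`sorry` appears nowhere.

## Index

* §0 NORMAL FORM. `ScarRigidityAt C` (the crux at a fixed Type-I constant); `scarRigidity_iff_forall_at`;
  `scarRigidityAt_anti` (slices antitone in `C`), `scarRigidity_twoConstants` (same `C` is WLOG);
  `scarRigidity_iff_pos` — only `0 < C` carries content (`pos_const_of_apexSingular`: decay constant of a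
  singular apex profile is positive; the `C ≤ 0` slices hold vacuously, `scarRigidityAt_of_nonpos`).
* §1 WHY IT RESISTS (logical core). `scarRigidity_of_noApexTypeIProfile` — the route TARGET implies the
  crux (vacuously: no singular apex profiles); `exists_singular_apex_of_not_scarRigidity` — any refutation
  of the crux EXHIBITS a suitable weak solution on `ℝ³×(−∞,0)` with `𝐈 < ∞`, `|u| ≤ C/(|x|+√−t)`, `C > 0`,
  singular at the origin, i.e. a Type-I blow-up profile (open; none is known).  Consequently every
  mutation below that keeps "both flows singular + apex decay + Navier–Stokes on the whole slab" is
  irrefutable by explicit construction, and the disproof perimeter is the LOAD-BEARING analysis.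
* §2 LOAD-BEARING HYPOTHESES (each: the crux with the named hypotheses dropped/weakened is FALSE, with an
  explicit witness pair):
  - (A⁺) `scarRigidity_false_without_navierStokes` — drop ONLY the two `IsSuitableWeakSolutionOn`
    hypotheses, keep weak gradients, `𝐈 < ∞`, the apex bound `C = 3`, BOTH singular origins, same scar:
    the kinematic bump `u = χ(|x|²/(−t))/√(−t) e₀` and `−u` (new in cycle 2; cycle 1's (A) dropped
    `𝐈 < ∞` as well).  The equations are load-bearing even inside the full A–B function class.
  - (B⁺) `scarRigidity_false_rate_without_morrey` — KEEP Navier–Stokes (classical on the open slab),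
    weak gradients, BOTH origins singular, same scar; weaken the apex bound to the Type-I RATE
    `|u| ≤ C/√(−t)` and drop `𝐈 < ∞`: the parasitic pair `b₁(t)e₀ = (C/√−t)e₀`, `b₂ = b₁ + (−t)/(1+t²)`
    (KNSS 2009 §1 / LYY 2024 Ex. 1.2) — new in cycle 2 (cycle 1's (B) also dropped singularity).  So the
    SPATIAL part of the Type-I hypothesis (`𝐈 < ∞` / decay at space infinity) is load-bearing even for
    genuinely singular Navier–Stokes pairs; the rate and the singularity are not what excludes drifts.
  - (B) `scarRigidity_false_without_decay` — cycle 1 (LYY Ex. 1.2 `u = t e` vs `0`), from the landed file.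
  - (D) `scarRigidity_false_local` — the crux is NOT local: false on every `Q_R(0,0)` with the apex bound
    (cycle 1, landed).
  - (C)/(C″) `scarRigidity_false_parabolicExterior`, `…_cubicDecay` — false on the parabolic exterior
    `{R√(−t) < |x|}` = `{|y| > R}` in similarity variables, for EVERY `C > 0`, even in the decay class
    `|W| = O(|y|⁻³)`: Serrin potential flows `c√(−t)∇Γ`, `c(−t)∇∂ₑΓ` (cycle 1, landed).  Kills the
    route's foreseen exterior lemma `LinearRellichExterior` as worded; the core `{|y| ≤ R}` (flux /
    regularity at the apex axis) is load-bearing.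
* §2′ THE HYPOTHESIS CUBE IS NOW FULLY CLASSIFIED (per flow: NS = suitable weak Navier–Stokes on the slab,
  Apex = `‖u‖ ≤ C/(‖x‖+√−t)`, Rate = `‖u‖ ≤ C/√−t`, I = `𝐈 < ∞`, Sing = backward-singular origin; always:
  weak gradients + same scar ⇒ a.e. equal):
  - NS ∧ Apex ∧ I ∧ Sing — the crux (open; ¬ ⇒ Type-I apex profile exists, §1);
  - drop NS (keep Apex ∧ I ∧ Sing) — FALSE (A⁺);
  - NS ∧ Rate ∧ Sing, no I — FALSE (B⁺); NS alone — FALSE (B); NS ∧ Apex locally / off the core — FALSE (D, C);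
  - NS ∧ Rate ∧ I ∧ Sing — irrefutable today: a witness pair needs a RATE-class singular profile with
    `𝐈 < ∞`, i.e. an Albritton–Barker Type-I singularity (registered OPEN fact `LocalTypeISingularityExists`;
    cf. the sibling disproof of `ApexLocalisation`, Theorems/ApexLocalisation/Negative);
  - NS ∧ I ∧ Sing (no pointwise bound) — same (A–B Type-I singular point = `𝐈 < ∞` + singular);
  - NS ∧ Apex ∧ Sing, no I — presumably equivalent to the crux (I redundant, §3);
  - any face without Sing — TRUE by Lei–Yang–Yuan 2024 Thm 1.1 + mildness from decay (not in tree), or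
    FALSE by (B) when the decay goes too.
* §3 NOT load-bearing for truth (paper, this docblock): dropping one or both SINGULARITY hypotheses
  only adds regular–regular pairs (backward uniqueness for bounded, spatially decaying — hence mild —
  solutions: LeiYangYuan2024 Thm 1.1 + Rmk 1.1, NOT in tree) and mixed pairs (excluded by NoMildScar,
  item 11723); `𝐈 < ∞` is plausibly REDUNDANT given `HasTypeIDecay` + suitability on the whole slab (paper:
  `A ≤ 4πC²`; `C(r) ≲ C³` since `∫_{B_r}(|x|+√−t)^{−3}dx ~ log(r/√−t)` is `dt`-integrable; the pressure is
  `RR(u⊗u) + h(t)` by spatial decay + Liouville, `‖RR(u⊗u)(t)‖_{L²} ≲ C²(−t)^{−1/4}` gives `D(r) ≲ C³` for the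
  MEAN-FREE `D` of the tree — which is blind to the gauge `h(t)`, so `𝐈 < ∞` does NOT fix the pressure gauge
  either; `E` from the local energy inequality).  Provers: the singularity hypotheses are needed for
  PROVABILITY in tree (LYY is not a tree fact), not for truth; `𝐈 < ∞` is free information, not a lever.
* §4 WHY IT RESISTS AT THE LINEAR LEVEL (paper, docstring of `linearMechanism_note`): in Leray variables
  the far field of an `e^{λs}`-mode of the linearised difference system around any decaying background
  splits into CALORIC slow branches `c_{lm} r^{−1−2λ}Y_{lm}` (scar `|x|^{−1−2λ}`, never zero),
  POTENTIAL multipoles `q_{lm}∇(r^{−l−1}Y_{lm})` (zero scar, the §2 (C) family) and forced corrections;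
  two-sided `s`-boundedness forces `Re λ = 0`, zero scar forces all `c_{lm} = 0`.  With the core and
  background `U = 0` every tempered eternal solution is a spatially CONSTANT parasitic mode `c(s)`
  (vorticity: Ornstein–Uhlenbeck spectral gap in `L²(e^{−|y|²/4})` kills every Hermite component of a
  two-sided bounded `Ω`; then `W(s)` is harmonic and bounded, hence constant — the Galilean mode of §2 (B)) —
  so at `U = 0` rigidity follows from ANY decay at space infinity and the scar is not needed: a SCAR-FREE
  statement.  The scar becomes the deciding datum only for backgrounds large enough to carry neutral modes,
  and a neutral mode with all caloric coefficients zero is a codimension-∞ coincidence for a one-parameter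
  family of backgrounds.  So kill
  criterion (i) of the route cannot fire generically at the linear level either; a linear kill needs an
  inverse-designed background (prescribe a zero-scar neutral `W`, solve the underdetermined first-order
  system `U·∇W + W·∇U + ∇Π = (L−½)W` for `U`), which no planner would accept as a profile.  Recorded as
  guidance: the content of the crux = absence of EMBEDDED zero-scar neutral modes = unique continuation
  from spatial infinity for the Stokes–Ornstein–Uhlenbeck system across a critical (`|U| ~ C/|y|`) core.
* §5 TARGETS (cycle 3). payload `targets = []`, `stuck_stubs = []`; the lead PICKED line
  `finite-energy-log-convexity` (PICKED.md 00:12Z; stubs stub_scarTwinFiniteEnergy [ticket: cubic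
  flatness + ‖w‖₂ ≲ (−t)^{1/4} + ‖w‖_{6/5} ≲ (−t)^{3/4} + ∇w ∈ L²], stub_logConvexityBelowThreshold [2C² < 1;
  NO singularity and NO scar hypothesis — the ticket replaces the scar], stub_noAnomalousExtinction [= the
  crux for 2C² ≥ 1 with the ticket]); the ledger skeleton is moment-conditioned-rellich's (paintedLadder /
  quadrupoleDefectVanishes / higherMomentsVanish / flatScarRigidity).  ALL stubs quantify over apex-class
  pairs, hence are irrefutable by construction (§1) — the only nonzero apex-class flows known would be
  Type-I profiles.  What §7 says about them: (i) the §7 mode satisfies FELC's finite-energy ticket EXACTLY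
  (it is the scaling class of the ticket) and the size hypotheses of any Carleman/weighted scheme, so
  stub_noAnomalousExtinction cannot be closed by a size-based argument and stub_logConvexityBelowThreshold's
  log-convexity in `Ḣ⁻¹` (Λ̇ ≤ ‖F‖²/2‖w‖², |t|^{2C²}Λ↓) is CONSISTENT with it (for a self-similar mode
  `Λ = Λ₀/|t|`, and the inequality forces `κ₀ = |t|^{1/2}‖F‖_{Ḣ⁻¹}/‖w‖₂ ≥ √2` — tautologically true here);
  (ii) MCR's stub_flatScarRigidity needs its `∀ N` (all radiative moments): at any FIXED flatness order the
  inequality-level statement is false (§7, `N = 3`; on paper every `N` via the `2^ℓ`-pole far fields);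
  (iii) stub_paintedLadder's first rung ("scar ⇒ |w| ≲ (−t)^{3/2}|x|⁻⁴") is consistent with §7 only
  because §7 is not an NS pair: the mode's `(−t)|x|⁻³` dipole tail is exactly the `ℓ = 1` painted term that
  momentum conservation of a TRUE pair kills (MCR card (ii)) — a proof of that rung must use the equations
  of `u₁, u₂` themselves, not the difference inequality (load-bearing, now certified).
* §7 (NEW, cycle 3 — the main finding) AN EXPLICIT ZERO-SCAR NEUTRAL MODE: the linearised /
  inequality level of the crux is NOT rigid.  `W = ζ⁵[(2−σ)m + 3(m·y)y]`, `Π`, and a RATIONAL critical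
  potential `M = θ(σ)y⊗y` with `ΔW − ½(y·∇)W − ½W − MW − ∇Π = 0` on `ℝ³` (`neutral_identity`), `div W = 0`,
  `|W|² ≤ 4/(1+σ)³`, `‖M‖ ≤ 30/(1+σ)`; refutes `NeutralModeRigidity 30`, `LinearisedScarRigidity 30`
  (eternal s-form) and, in physical variables on the whole slab, `DifferenceInequalityRigidity 30`
  (`∂ₜw − Δw + 𝓜w + ∇π = 0`, `|𝓜| ≤ 30/((−t)+|x|²)`, apex Type-I + cubic flatness + finite energy +
  singular apex, `w ≠ 0`).  MEANING: any proof must use more about `ū = (u₁+u₂)/2` than its Type-I sizes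
  (e.g. the profile equation of `ū`, or the exact Jacobian structure `w·∇ū` with `div ū = 0` — NOT
  exhibited by §7, whose `M` is not a Jacobian: the exact-structure inverse problem is OPEN, a transport
  problem along the closed streamlines of `W`); the layer-2 "DifferenceDecay → NonlinearAbsorption" is dead
  as a coefficient scheme; the non-rigidity is a PRESSURE effect (the scalar analogue with the same
  potential bound is rigid by ESS + space-like UC).  Sympy/numerics job j007772 (constants, `‖M‖_{L³}`,
  Plummer-scale scan) attaches itself to the item.  §7.11 (paper): the §7 mode is NOT an exact-structure
  neutral mode around ANY div-free background (`∫ρ = −∫ΔG = 4π ≠ 0`: momentum conservation = MCR's `ℓ = 1`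
  law); the quadrupole-tailed exact-structure question is posed (both Killing obstructions vanish) with LSQ
  numerics j008767/j008913 pending.
* §6 LITERATURE (cycle 2 re-check, 2026-08-15/16; searchd rc75, OpenAlex/S2 HTTP 429, zbMATH+arXiv+galaxy up):
  backward uniqueness with NON-trivial final data for Navier–Stokes: still only LeiYangYuan2024 (zbMATH 1 hit,
  arXiv 1 hit; bounded mild class) — nothing on the singular/Type-I apex case, no refutation in print.  New
  PROVER-side tools found (not kills): Colding–Minicozzi, *Parabolic frequency on manifolds*, IMRN 2022
  (arXiv:2002.11015) — frequency monotonicity for drift Laplacians ⇒ backward uniqueness for the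
  Ornstein–Uhlenbeck heat equation; Sun–Wang, *Parabolic frequency on Gaussian spaces and unique
  continuation*, arXiv:2512.10139 (Dec 2025) — OU operator `Δ − x·∇` with BOUNDED drift `b` and linear-growth
  potential `c`, solutions of exponential-quadratic growth, Mehler-kernel weights: almost-monotone frequency,
  strong unique continuation (read pp. 1–3).  In Leray variables the scalar part of the difference system has
  exactly this shape (`U`, `∇U` bounded); what neither covers is the non-local pressure `∇Π = ∇RR(U⊗W+W⊗U)` —
  the planner's why-might-fail, and the reason LYY needed new weights.  Lin–Uhlmann–Wang 2010 (three-ball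
  inequalities for Stokes, arXiv:0812.3730) is the quantitative-uniqueness end for the STEADY Stokes system.
  Cycle 3 re-check (2026-08-16; searchd rc75 again, zbMATH up): zbMATH "backward uniqueness Navier-Stokes"
  ≥2022 (28 rows: LYY 2024 = doi:10.1093/imrn/rnae208 the only relevant; Taniuchi, Math. Ann. 389 (2024)
  doi:10.1007/s00208-023-02702-x — uniqueness of mild `L^{3,∞}` solutions on the whole time axis, a small-data
  Liouville theorem relevant to "the apex class at small C is {0}"); "Type I blow-up Navier-Stokes" ≥2023
  (11: Q. S. Zhang arXiv:2604.07785 partial Type I axisymmetric; Cheskidov–Dai–Palasek arXiv:2511.09556 =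
  catalogued barrier InstantaneousTypeIBlowup; Barker 2024); "unique continuation Stokes" (15, none on
  singular/critical lower-order terms); "backward uniqueness parabolic counterexample" (0); "Landis
  conjecture parabolic" (2, fractional/decay).  NOTHING found on non-uniqueness / neutral modes for the
  Stokes system with critical potentials: the §7 mode appears to be new as a statement (its ingredients —
  Serrin potential flows, Plummer regularisation — are classical).  Flag for the summit (not this crux):
  arXiv:2604.09949 (Apr 2026, anonymous-looking CAP preprint) CLAIMS a stable nearly self-similar finite-time
  singularity for 3D NS on T³ via a 5D-lifted axisymmetric profile — if Type I and axisymmetric it contradicts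
  Seregin–Šverák 2009 (tree `AxisymmetricTypeIExclusion_holds`, PROVED); unrefereed, treat as noise pending
  scrutiny.


* §8 (NEW, cycle 4 — read first) THE SMALL-CONSTANT SLICES ARE VACUOUS UP TO `C ≈ 1.16`.  Liouville by
  Oseen-kernel contraction in the apex normalisation: every ancient Oseen-mild field with
  `|u| ≤ C/(|x|+√−t)`, `C < C_L = 1/κ♯ ≈ 1.16`, is `0` (`κ♯ = 0.8594`: the SHARP majorant constant — `λ_max` of
  the symmetrised Oseen-gradient quadratic form, worst output direction `n = −x/|x|` at `|x| ≈ 11√(−t)`; the crude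
  kernel already gives `C < 0.700`; the capped monotone iteration of the same majorant map pushes the threshold to
  `C_maj ≈ 1.5`; evidence `liouville-vacuity.md`, kit job j010409).  Lean: `ApexLiouville C₀`,
  `scarRigidityAt_of_apexLiouville` (Liouville threshold ⇒ the slices below it hold vacuously),
  `scarRigidity_iff_above_liouville`, `bootstrap_eq_zero` — LANDED as `Negative/ApexLiouvilleVacuity.lean` (p76085).  CONSEQUENCE for line finite-energy-log-convexity: the regime `2C² < 1` (`C < 0.7071`) of
  `stub_logConvexityBelowThreshold` contains only `V₁ = V₂ = 0` — S4 is true but the line's theorem-sized output is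
  vacuous; the content of the crux starts at `C ≥ 1.5`, inside S5 (= the crux, drefute's costume note), where
  size-based log-convexity is saturated by §7.  The `+√(−t)` of the apex bound is what Liouville uses (Landau's
  `−1`-homogeneous steady flows have arbitrarily small `sup |x||U|` but are not bounded at the apex axis).
* §9 (NEW, cycle 4) DIVERGENCE-FORM COUPLINGS.  (a) The momentum obstruction of §7.11 holds for EVERY
  divergence-form coupling `∇·(U₁⊗W + W⊗U₂)` with INDEPENDENT divergence-free Type-I-size coefficient fields
  `U₁ ≠ U₂` (the crux's own linearised wording): the dipole-tailed §7 mode is a neutral mode of no such operator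
  (paper theorem `divergenceForm_dipole_obstruction_note`).  (b) For zero-net-force modes (`W₂ = ∂_z W₁`,
  quadrupole tail = flatness `(−t)^{3/2}|x|⁻⁴`) the inverse problem is transport along the CLOSED meridional
  streamlines of `W`: drift-only (`U₂ = 0`) and stretch-only (`U₁ = 0`) couplings are each obstructed by one
  orbital condition per streamline, independent `(U₁,U₂)` is generically solvable, the exact linearisation
  `U₁ = U₂ = Ū` is a balanced Fredholm-type problem — a naive rational-basis least squares is ill-conditioned
  and inconclusive (control and test alike), a spectral collocation job j011078 is queued, verdict to be folded in.  (c) Half-space / exterior backward uniqueness "with a pressure gradient" is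
  trivially false by pressure-driven potential flows singular outside the domain (the §2 (C)/(D) mechanism), so
  the meaningful negative statements are the WHOLE-SPACE ones of §7 — recorded to stop re-derivations.
* §10 (cycle 4) LITERATURE: searchd rc75 and arXiv HTTP 429 again (degraded); zbMATH up — "backward uniqueness
  Navier–Stokes" ≥ 2023 unchanged (LYY 2024; Taniuchi 2024 = small `L^{3,∞}` Liouville on the whole time axis,
  consistent with §8 but with a non-explicit constant); nothing on explicit Liouville constants in the apex
  normalisation (§8's number appears to be new as a statement; its ingredients are Solonnikov's kernel formulas).

## Summary for provers

Any proof of `ScarRigidity` must use: the Navier–Stokes equations (A⁺), decay at SPATIAL infinity on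
whole time slices — `𝐈 < ∞` or the `‖x‖` in the apex bound — and not merely the rate or the
singularity (B⁺, B), globality in space (D), the equations ACROSS the parabolic core `|x| ≲ √(−t)`
down to the apex axis, with no decay-rate hypothesis able to replace them (C, C″), AND (§7, cycle 3) more
about the background `ū` of the difference equation than its Type-I SIZE: at zeroth-order coefficient size
`30/((−t)+|x|²)` the difference inequality has an explicit eternal self-similar solution with apex Type-I
bound, zero scar (cubic flatness), finite energy and a singular apex.  So: no Carleman / weighted /
log-convexity estimate that sees `w·∇ū` only through `|∇ū| ≲ C/(|x|+√−t)²` can close the crux for large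
`C`; thresholds (FELC's `2C² < 1`) are the honest reach of size-based methods, and above them the profile
equation of `ū` (or the exact Jacobian/divergence structure) must enter.  The same-`C` normalisation is
WLOG; `C ≤ 0` is vacuous; `C < ε₀` (CKN/`L^{3,∞}` ε-regularity) is vacuous too — and (§8, cycle 4) so is EVERY
`C < 1.16` (one step) and, numerically, every `C < 1.5` (capped iteration): below that constant the apex class is
`{0}` by an elementary Oseen-kernel contraction, so a threshold theorem (FELC's `2C² < 1`, i.e. `C < 0.71`) proves
nothing that Liouville does not, and the first constant at which `ScarRigidityAt C` has content is `C ≈ 1.5` or larger.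
-/

noncomputable section

open Set Filter Function MeasureTheory Metric TopologicalSpace
open scoped Topology ENNReal NNReal InnerProductSpace RealInnerProductSpace Laplacian

set_option linter.dupNamespace false

namespace Summit.NavierStokesRegularity.NavierStokesRegularity.Cruxes.ScarRigidity.Disproof

open Literature.Analysis.FluidPDE
open Summit.NavierStokesRegularity.NavierStokesRegularity.Theses.RellichScar

/-- Physical space. -/
local notation "ℝ³" => EuclideanSpace ℝ (Fin 3)

/-- The open backward slab `(-∞,0) × ℝ³` (time first). -/
local notation "𝕊" => slab (EuclideanSpace ℝ (Fin 3)) (Iio (0 : ℝ)) isOpen_Iio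

/-! ## §0 Normal form -/

/-- SAME SCAR (verbatim the hypothesis of the crux): `ess sup_{(−δ,0)×K} ‖u₁ − u₂‖ → 0` as `δ ↓ 0`
for every compact `K ∌ 0`. -/
def SameScar (u₁ u₂ : ℝ → ℝ³ → ℝ³) : Prop :=
  ∀ K : Set ℝ³, IsCompact K → (0 : ℝ³) ∉ K →
    Tendsto (fun δ : ℝ => eLpNorm (uncurry u₁ - uncurry u₂) ⊤
      (volume.restrict (Ioo (-δ) 0 ×ˢ K))) (𝓝[>] 0) (𝓝 0)

/-- The conclusion of the crux: a.e. equality on the slab. -/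
def AeEqSlab (u₁ u₂ : ℝ → ℝ³ → ℝ³) : Prop :=
  uncurry u₁ =ᵐ[volume.restrict (Iio (0 : ℝ) ×ˢ (univ : Set ℝ³))] uncurry u₂

/-- The crux at a FIXED Type-I constant `C` (all other binders verbatim). -/
def ScarRigidityAt (C : ℝ) : Prop :=
  ∀ (u₁ : ℝ → ℝ³ → ℝ³) (p₁ : ℝ → ℝ³ → ℝ) (G₁ : ℝ → ℝ³ → ℝ³ →L[ℝ] ℝ³)
    (u₂ : ℝ → ℝ³ → ℝ³) (p₂ : ℝ → ℝ³ → ℝ) (G₂ : ℝ → ℝ³ → ℝ³ →L[ℝ] ℝ³),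
    IsSuitableWeakSolutionOn 𝕊 1 0 u₁ p₁ → HasWeakSpatialGradientOn 𝕊 u₁ G₁ →
    typeIBound (Iio (0 : ℝ) ×ˢ univ) u₁ p₁ G₁ < ⊤ → HasTypeIDecay C u₁ →
    IsSuitableWeakSolutionOn 𝕊 1 0 u₂ p₂ → HasWeakSpatialGradientOn 𝕊 u₂ G₂ →
    typeIBound (Iio (0 : ℝ) ×ˢ univ) u₂ p₂ G₂ < ⊤ → HasTypeIDecay C u₂ →
    IsBackwardSingularPoint u₁ 0 → IsBackwardSingularPoint u₂ 0 →
    SameScar u₁ u₂ → AeEqSlab u₁ u₂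

/-- `ScarRigidity ↔ ∀ C, ScarRigidityAt C` (the crux binds `C` last; pure binder shuffling). -/
theorem scarRigidity_iff_forall_at : ScarRigidity ↔ ∀ C : ℝ, ScarRigidityAt C :=
  ⟨fun h C u₁ p₁ G₁ u₂ p₂ G₂ => h u₁ p₁ G₁ u₂ p₂ G₂ C,
    fun h u₁ p₁ G₁ u₂ p₂ G₂ C => h C u₁ p₁ G₁ u₂ p₂ G₂⟩

/-- A function vanishing on the open past slab has `ess sup = 0 ≠ ∞` on `Q_1(0,0)`, so the origin is
NOT backward-singular for it. [folklore] -/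
theorem not_isBackwardSingularPoint_of_eq_zero {u : ℝ → ℝ³ → ℝ³} (h : ∀ t < 0, ∀ x, u t x = 0) :
    ¬ IsBackwardSingularPoint u 0 := by
  intro hs
  have h1 := hs 1 one_pos
  have hae : uncurry u =ᵐ[volume.restrict (parabolicCylinder 1 (0 : ℝ × ℝ³))] 0 := by
    filter_upwards [ae_restrict_mem (isOpen_parabolicCylinder 1 (0 : ℝ × ℝ³)).measurableSet] with z hz
    rw [mem_parabolicCylinder] at hz
    have ht : z.1 < 0 := by simpa using hz.1.2
    simp [uncurry, h z.1 ht z.2]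
  rw [eLpNorm_congr_ae hae, eLpNorm_zero] at h1
  exact ENNReal.zero_ne_top h1

/-- DEGENERATE CONSTANTS: the Type-I constant of a backward-singular apex profile is POSITIVE
(`C ≤ 0` forces `u = 0` on `t < 0`, which is not singular).  Hence only the slices `0 < C` of the crux
carry content. [folklore] -/
theorem pos_const_of_apexSingular {C : ℝ} {u : ℝ → ℝ³ → ℝ³} (hd : HasTypeIDecay C u)
    (hs : IsBackwardSingularPoint u 0) : 0 < C := by
  by_contra hC
  have hC : C ≤ 0 := not_lt.1 hC
  refine not_isBackwardSingularPoint_of_eq_zero (fun t ht x => ?_) hs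
  have hden : 0 < ‖x‖ + Real.sqrt (-t) :=
    add_pos_of_nonneg_of_pos (norm_nonneg _) (Real.sqrt_pos.2 (by linarith))
  have := hd t ht x
  have hle : C / (‖x‖ + Real.sqrt (-t)) ≤ 0 := div_nonpos_of_nonpos_of_nonneg hC hden.le
  exact norm_le_zero_iff.1 (this.trans hle)

/-- The `C ≤ 0` slices of the crux hold (vacuously). -/
theorem scarRigidityAt_of_nonpos {C : ℝ} (hC : C ≤ 0) : ScarRigidityAt C := by
  intro u₁ p₁ G₁ u₂ p₂ G₂ _ _ _ hd₁ _ _ _ _ hs₁ _ _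
  exact absurd (pos_const_of_apexSingular hd₁ hs₁) (not_lt.2 hC)

/-- NORMAL FORM: the crux is its family of positive-constant slices. -/
theorem scarRigidity_iff_pos : ScarRigidity ↔ ∀ C : ℝ, 0 < C → ScarRigidityAt C := by
  rw [scarRigidity_iff_forall_at]
  refine ⟨fun h C _ => h C, fun h C => ?_⟩
  rcases le_or_gt C 0 with hC | hC
  · exact scarRigidityAt_of_nonpos hC
  · exact h C hC

/-- Monotonicity of the apex bound in the constant. [folklore] -/
theorem hasTypeIDecay_mono {C C' : ℝ} (hCC' : C ≤ C') {u : ℝ → ℝ³ → ℝ³} (h : HasTypeIDecay C u) :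
    HasTypeIDecay C' u := fun t ht x => by
  refine (h t ht x).trans (div_le_div_of_nonneg_right hCC' ?_)
  exact (add_pos_of_nonneg_of_pos (norm_nonneg _) (Real.sqrt_pos.2 (by linarith))).le

/-- The slices are ANTITONE in `C` (a larger constant is a larger class): a threshold theorem
`∀ C < C₀, ScarRigidityAt C` is exactly the crux restricted to profiles of Type-I constant `< C₀`. -/
theorem scarRigidityAt_anti {C C' : ℝ} (hCC' : C ≤ C') (h : ScarRigidityAt C') : ScarRigidityAt C := by
  intro u₁ p₁ G₁ u₂ p₂ G₂ hs₁ hg₁ hI₁ hd₁ hs₂ hg₂ hI₂ hd₂ hsing₁ hsing₂ hscar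
  exact h u₁ p₁ G₁ u₂ p₂ G₂ hs₁ hg₁ hI₁ (hasTypeIDecay_mono hCC' hd₁) hs₂ hg₂ hI₂
    (hasTypeIDecay_mono hCC' hd₂) hsing₁ hsing₂ hscar

/-- SAME-`C` IS WLOG: the crux implies its two-constant form (weaken both to `max C₁ C₂`). -/
theorem scarRigidity_twoConstants (h : ScarRigidity) :
    ∀ (u₁ : ℝ → ℝ³ → ℝ³) (p₁ : ℝ → ℝ³ → ℝ) (G₁ : ℝ → ℝ³ → ℝ³ →L[ℝ] ℝ³)
      (u₂ : ℝ → ℝ³ → ℝ³) (p₂ : ℝ → ℝ³ → ℝ) (G₂ : ℝ → ℝ³ → ℝ³ →L[ℝ] ℝ³) (C₁ C₂ : ℝ),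
      IsSuitableWeakSolutionOn 𝕊 1 0 u₁ p₁ → HasWeakSpatialGradientOn 𝕊 u₁ G₁ →
      typeIBound (Iio (0 : ℝ) ×ˢ univ) u₁ p₁ G₁ < ⊤ → HasTypeIDecay C₁ u₁ →
      IsSuitableWeakSolutionOn 𝕊 1 0 u₂ p₂ → HasWeakSpatialGradientOn 𝕊 u₂ G₂ →
      typeIBound (Iio (0 : ℝ) ×ˢ univ) u₂ p₂ G₂ < ⊤ → HasTypeIDecay C₂ u₂ →
      IsBackwardSingularPoint u₁ 0 → IsBackwardSingularPoint u₂ 0 →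
      SameScar u₁ u₂ → AeEqSlab u₁ u₂ := by
  intro u₁ p₁ G₁ u₂ p₂ G₂ C₁ C₂ hs₁ hg₁ hI₁ hd₁ hs₂ hg₂ hI₂ hd₂ hsing₁ hsing₂ hscar
  exact h u₁ p₁ G₁ u₂ p₂ G₂ (max C₁ C₂) hs₁ hg₁ hI₁ (hasTypeIDecay_mono (le_max_left _ _) hd₁) hs₂ hg₂ hI₂
    (hasTypeIDecay_mono (le_max_right _ _) hd₂) hsing₁ hsing₂ hscar

/-! ## §1 Why it resists: the logical core -/

/-- TARGET ⇒ CRUX: if no singular apex profile exists (the route target `NoApexTypeIProfile`, a form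
of the Liouville conjecture), `ScarRigidity` holds vacuously.  So the crux is conditional content, not
a restatement, and it is TRUE in the believed world. -/
theorem scarRigidity_of_noApexTypeIProfile (hX : NoApexTypeIProfile) : ScarRigidity := by
  intro u₁ p₁ G₁ u₂ p₂ G₂ C hs₁ hg₁ hI₁ hd₁ _ _ _ _ hsing₁ _ _
  exact absurd hsing₁ (hX u₁ p₁ G₁ C hs₁ hg₁ hI₁ hd₁)

/-- ¬CRUX ⇒ A TYPE-I BLOW-UP PROFILE: any refutation of `ScarRigidity` exhibits a suitable weak
solution of Navier–Stokes on `ℝ³ × (−∞,0)` with `𝐈 < ∞`, the apex bound with a constant `C > 0`, and a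
backward-singular origin (Albritton–Barker 2019 Thm 1.1's Type-I singularity, KNSS (1.6) form) — an
object whose existence is the open heart of the summit.  This is WHY THE CRUX RESISTS every explicit
attack: no such profile is known, and every witness pair one can write down is regular. -/
theorem exists_singular_apex_of_not_scarRigidity (h : ¬ ScarRigidity) :
    ∃ (C : ℝ) (u : ℝ → ℝ³ → ℝ³) (p : ℝ → ℝ³ → ℝ) (G : ℝ → ℝ³ → ℝ³ →L[ℝ] ℝ³), 0 < C ∧
      IsSuitableWeakSolutionOn 𝕊 1 0 u p ∧ HasWeakSpatialGradientOn 𝕊 u G ∧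
      typeIBound (Iio (0 : ℝ) ×ˢ univ) u p G < ⊤ ∧ HasTypeIDecay C u ∧ IsBackwardSingularPoint u 0 := by
  by_contra hne
  refine h (scarRigidity_of_noApexTypeIProfile fun u p G C hs hg hI hd hsing => ?_)
  exact hne ⟨C, u, p, G, pos_const_of_apexSingular hd hsing, hs, hg, hI, hd, hsing⟩

/-- Conversely the crux does not (cheaply) give back the target: the symmetry images of a singular apex
profile that stay in the class — rescalings, rotations, the parity image `−u(t,−x)` — have the SAME scar
only when the scar is homogeneous / axisymmetric / odd, and only the first two are killed by Liouville
theorems in tree (Tsai 1998, Seregin–Šverák 2009).  Recorded as a remark; nothing to prove. -/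
theorem crux_not_known_equivalent_to_target : True := trivial

/-! ## §2 Load-bearing hypotheses

### (A⁺) The Navier–Stokes equations (new, cycle 2)

Drop ONLY `IsSuitableWeakSolutionOn` (for both flows); keep the weak gradients, `𝐈 < ∞` (with the
quantified pressures), the apex bound, both singular origins and the scar hypothesis.  FALSE: the
kinematic bump of `KinematicApexWitness` and its negative. -/

/-- The crux with the two Navier–Stokes hypotheses deleted (everything else verbatim). -/
def ScarRigidityWithoutNavierStokes : Prop :=
  ∀ (u₁ : ℝ → ℝ³ → ℝ³) (p₁ : ℝ → ℝ³ → ℝ) (G₁ : ℝ → ℝ³ → ℝ³ →L[ℝ] ℝ³)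
    (u₂ : ℝ → ℝ³ → ℝ³) (p₂ : ℝ → ℝ³ → ℝ) (G₂ : ℝ → ℝ³ → ℝ³ →L[ℝ] ℝ³) (C : ℝ),
    HasWeakSpatialGradientOn 𝕊 u₁ G₁ → typeIBound (Iio (0 : ℝ) ×ˢ univ) u₁ p₁ G₁ < ⊤ →
    HasTypeIDecay C u₁ →
    HasWeakSpatialGradientOn 𝕊 u₂ G₂ → typeIBound (Iio (0 : ℝ) ×ˢ univ) u₂ p₂ G₂ < ⊤ →
    HasTypeIDecay C u₂ →
    IsBackwardSingularPoint u₁ 0 → IsBackwardSingularPoint u₂ 0 →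
    SameScar u₁ u₂ → AeEqSlab u₁ u₂

/-- `|−A|² = |A|²` for the Frobenius norm (local copy of `frobeniusNormSq_neg`, `TrilinearSkew`). [folklore] -/
theorem frobeniusNormSq_neg' (A : ℝ³ →L[ℝ] ℝ³) : frobeniusNormSq (-A) = frobeniusNormSq A := by
  simp [frobeniusNormSq]

/-- NEGATION RULE for weak spatial gradients: `−G` is a weak gradient of `−u`. [folklore] -/
theorem hasWeakSpatialGradientOn_neg {Q : Opens (ℝ × ℝ³)} {u : ℝ → ℝ³ → ℝ³}
    {G : ℝ → ℝ³ → ℝ³ →L[ℝ] ℝ³} (h : HasWeakSpatialGradientOn Q u G) :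
    HasWeakSpatialGradientOn Q (fun t x => -u t x) (fun t x => -G t x) where
  locallyIntegrableOn := by
    have e : uncurry (fun t x => -u t x) = -uncurry u := rfl
    rw [e]; exact h.locallyIntegrableOn.neg
  locallyIntegrableOn_grad := by
    have e : uncurry (fun t x => -G t x) = -uncurry G := rfl
    rw [e]; exact h.locallyIntegrableOn_grad.neg
  integral_fderiv_mul_inner_eq φ hφ v w := by
    have e := h.integral_fderiv_mul_inner_eq φ hφ v w
    simp only [neg_apply, inner_neg_left, mul_neg, integral_neg, e, neg_neg]

/-- `𝐈` is blind to the sign of `(u, G)` (every scaled quantity is a norm). [folklore] -/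
theorem typeIBound_neg (ω : Set (ℝ × ℝ³)) (u : ℝ → ℝ³ → ℝ³) (p : ℝ → ℝ³ → ℝ)
    (G : ℝ → ℝ³ → ℝ³ →L[ℝ] ℝ³) :
    typeIBound ω (fun t x => -u t x) p (fun t x => -G t x) = typeIBound ω u p G := by
  simp only [typeIBound, abScaledSum, cknAEss, cknC, cknE, enorm_neg, frobeniusNormSq_neg']

/-- Sign-blindness of the apex bound. [folklore] -/
theorem hasTypeIDecay_neg {C : ℝ} {u : ℝ → ℝ³ → ℝ³} (h : HasTypeIDecay C u) :
    HasTypeIDecay C (fun t x => -u t x) := fun t ht x => by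
  rw [norm_neg]; exact h t ht x

/-- Sign-blindness of backward singular points. [folklore] -/
theorem isBackwardSingularPoint_neg {u : ℝ → ℝ³ → ℝ³} {z : ℝ × ℝ³} (h : IsBackwardSingularPoint u z) :
    IsBackwardSingularPoint (fun t x => -u t x) z := fun r hr => by
  have e : uncurry (fun t x => -u t x) = -uncurry u := rfl
  rw [e, eLpNorm_neg]; exact h r hr

/-- A compact set missing the origin keeps a positive distance `ρ` from it. [folklore] -/
theorem exists_pos_le_norm_of_isCompact {K : Set ℝ³} (hK : IsCompact K) (h0 : (0 : ℝ³) ∉ K) :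
    ∃ ρ : ℝ, 0 < ρ ∧ ∀ x ∈ K, ρ ≤ ‖x‖ := by
  obtain ⟨ρ, hρ, hball⟩ := Metric.isOpen_iff.1 hK.isClosed.isOpen_compl 0 h0
  refine ⟨ρ, hρ, fun x hx => ?_⟩
  by_contra hlt
  have hlt : ‖x‖ < ρ := not_le.1 hlt
  exact hball (by simpa using hlt) hx

open ParabolicBump in
/-- The kinematic bump has ZERO SCAR against any multiple of itself: for compact `K ∌ 0` and
`δ ≤ ρ²/4` it vanishes identically on `(−δ,0) × K` (support `‖x‖ < 2√(−t)`). [folklore] -/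
theorem sameScar_apex_neg : SameScar apexVelocity (fun t x => -apexVelocity t x) := by
  intro K hK h0
  obtain ⟨ρ, hρ, hKρ⟩ := exists_pos_le_norm_of_isCompact hK h0
  have hev : ∀ᶠ δ in 𝓝[>] (0 : ℝ), eLpNorm (uncurry apexVelocity - uncurry fun t x => -apexVelocity t x) ⊤
      (volume.restrict (Ioo (-δ) 0 ×ˢ K)) = 0 := by
    have hmem : Ioo (0 : ℝ) (ρ ^ 2 / 4) ∈ 𝓝[>] (0 : ℝ) := Ioo_mem_nhdsGT (by positivity)
    filter_upwards [hmem] with δ hδ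
    have hae : (uncurry apexVelocity - uncurry fun t x => -apexVelocity t x)
        =ᵐ[volume.restrict (Ioo (-δ) 0 ×ˢ K)] 0 := by
      filter_upwards [ae_restrict_mem (measurableSet_Ioo.prod hK.isClosed.measurableSet)] with z hz
      obtain ⟨⟨hz1, hz2⟩, hzK⟩ := hz
      have ht : z.1 < 0 := hz2
      have hsqrt : 2 * Real.sqrt (-z.1) ≤ ‖z.2‖ := by
        refine le_trans ?_ (hKρ z.2 hzK)
        have h1 : -z.1 < ρ ^ 2 / 4 := by linarith [hδ.2]
        have h2 : Real.sqrt (-z.1) < ρ / 2 := by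
          calc Real.sqrt (-z.1) < Real.sqrt (ρ ^ 2 / 4) := Real.sqrt_lt_sqrt (by linarith) h1
            _ = ρ / 2 := by
              rw [show ρ ^ 2 / 4 = (ρ / 2) ^ 2 by ring, Real.sqrt_sq (by linarith)]
        linarith
      have hzero := apexVelocity_eq_zero_of ht hsqrt
      simp [uncurry, hzero]
    rw [eLpNorm_congr_ae hae, eLpNorm_zero]
  exact (tendsto_congr' hev).2 tendsto_const_nhds

open ParabolicBump in
/-- **(A⁺) The Navier–Stokes equations are load-bearing, even inside the full A–B class.**
`u₁ = χ(|x|²/(−t))/√(−t) e₀`, `u₂ = −u₁`, `p = 0`, `G₂ = −G₁`, `C = 3`: weak gradients, `𝐈 < ∞`, apex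
bound, both singular at the origin, identical (zero) scars — and `u₁ ≠ u₂` on the open set
`{‖x‖² < −t}` of positive measure. -/
theorem scarRigidity_false_without_navierStokes : ¬ ScarRigidityWithoutNavierStokes := by
  intro h
  have hG := apex_hasWeakSpatialGradientOn
  have hI := typeIBound_apex_lt_top
  have hI' : typeIBound (Iio (0 : ℝ) ×ˢ univ) (fun t x => -apexVelocity t x) 0
      (fun t x => -apexGradient t x) < ⊤ := by
    rw [typeIBound_neg]; exact hI
  have hae := h apexVelocity 0 apexGradient (fun t x => -apexVelocity t x) 0 (fun t x => -apexGradient t x)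
    3 hG hI apex_hasTypeIDecay (hasWeakSpatialGradientOn_neg hG) hI' (hasTypeIDecay_neg apex_hasTypeIDecay)
    apex_isBackwardSingularPoint (isBackwardSingularPoint_neg apex_isBackwardSingularPoint)
    sameScar_apex_neg
  -- the two fields differ on the open set `{t < 0, ‖x‖² < −t}`
  set U : Set (ℝ × ℝ³) := {z | z.1 < 0 ∧ ‖z.2‖ ^ 2 < -z.1} with hUdef
  have hU : IsOpen U :=
    (isOpen_lt continuous_fst continuous_const).inter
      (isOpen_lt (continuous_snd.norm.pow 2) continuous_fst.neg)
  have hUne : U.Nonempty := ⟨((-1 : ℝ), (0 : ℝ³)), by simp [hUdef]⟩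
  have hUS : U ⊆ Iio (0 : ℝ) ×ˢ (univ : Set ℝ³) := fun z hz => ⟨hz.1, mem_univ _⟩
  refine not_aeEq_restrict_of_forall_ne_of_isOpen hU hUne hUS (fun z hz => ?_) hae
  obtain ⟨ht, hx⟩ := hz
  simp only [uncurry]
  intro heq
  have hamp : apexAmp z.1 z.2 = 1 / Real.sqrt (-z.1) := apexAmp_eq_of ht hx.le
  have hpos : 0 < apexAmp z.1 z.2 := by rw [hamp]; exact div_pos one_pos (Real.sqrt_pos.2 (by linarith))
  have hsum : (apexAmp z.1 z.2 + apexAmp z.1 z.2) • parasiticDir = 0 := by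
    rw [add_smul]
    exact eq_neg_iff_add_eq_zero.1 heq
  rcases smul_eq_zero.1 hsum with hzero | hdir
  · linarith
  · have := norm_parasiticDir
    rw [hdir, norm_zero] at this
    exact zero_ne_one this

/-! ### (B⁺) Decay at spatial infinity — the rate and the singularity do not exclude drifts (new, cycle 2)

KEEP the Navier–Stokes equations (classical, hence suitable weak, on the open slab), the weak gradients,
BOTH origins backward-singular and the scar hypothesis; WEAKEN the apex bound `C/(‖x‖+√−t)` to the
Type-I RATE `C/√−t` and DROP `𝐈 < ∞`.  FALSE: two parasitic (Galilean, KNSS 2009 §1) flows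
`b₁(t) = (C/√−t) e₀` and `b₂(t) = b₁(t) + ((−t)/(1+t²)) e₀`, `pᵢ = −bᵢ′(t)·x`. -/

/-- The spatially uniform flow with scalar amplitude `a(t)` along `e₀`: `u(t,x) = a(t) e₀`. [folklore] -/
def ampDrift (a : ℝ → ℝ) : ℝ → ℝ³ → ℝ³ := fun t _ => a t • parasiticDir

/-- Its pressure `p(t,x) = ⟪−a′(t) e₀, x⟫` (`∂ₜu = −∇p`). [folklore] -/
def ampDriftPressure (a : ℝ → ℝ) : ℝ → ℝ³ → ℝ := fun t x => ⟪(-deriv a t) • parasiticDir, x⟫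

/-- The parasitic flow of the tree is the drift with amplitude `C/√(−t)`. -/
theorem parasiticVelocity_eq (C : ℝ) : parasiticVelocity C = ampDrift (parasiticAmp C) := rfl

section Drift

variable {a : ℝ → ℝ}

/-- Joint smoothness of the drift on the open slab. [folklore] -/
theorem contDiffOn_ampDrift {n : WithTop ℕ∞} (ha : ContDiffOn ℝ n a (Iio 0)) :
    ContDiffOn ℝ n (uncurry (ampDrift a)) (Iio 0 ×ˢ univ) := by
  have h : ContDiffOn ℝ n (fun z : ℝ × ℝ³ => a z.1) (Iio 0 ×ˢ univ) :=
    ha.comp contDiffOn_fst fun z hz => hz.1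
  exact h.smul contDiffOn_const

/-- Joint `C¹` smoothness of the drift pressure on the open slab. [folklore] -/
theorem contDiffOn_ampDriftPressure (ha : ContDiffOn ℝ 2 a (Iio 0)) :
    ContDiffOn ℝ 1 (uncurry (ampDriftPressure a)) (Iio 0 ×ˢ univ) := by
  have ha' : ContDiffOn ℝ (1 + 1) a (Iio 0) := by rw [one_add_one_eq_two]; exact ha
  have h1 : ContDiffOn ℝ 1 (deriv a) (Iio 0) := ha'.deriv_of_isOpen isOpen_Iio le_rfl
  have h2 : ContDiffOn ℝ 1 (fun z : ℝ × ℝ³ => (-deriv a z.1) • parasiticDir) (Iio 0 ×ˢ univ) :=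
    ((h1.comp contDiffOn_fst fun z hz => hz.1).neg).smul contDiffOn_const
  exact h2.inner ℝ contDiffOn_snd

/-- `∂ₜu = a′(t) e₀` on `t < 0`. [folklore] -/
theorem timeDeriv_ampDrift (ha : ContDiffOn ℝ 2 a (Iio 0)) {t : ℝ} (ht : t < 0) (x : ℝ³) :
    timeDeriv (ampDrift a) t x = deriv a t • parasiticDir := by
  simp only [timeDeriv_apply, ampDrift]
  have hd : DifferentiableAt ℝ a t :=
    (ha.differentiableOn (by norm_num)).differentiableAt (Iio_mem_nhds ht)
  exact (hd.hasDerivAt.smul_const parasiticDir).deriv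

/-- The drift pair solves Navier–Stokes (`ν = 1`, `f = 0`) pointwise on `t < 0`. [folklore] -/
theorem momentum_ampDrift (ha : ContDiffOn ℝ 2 a (Iio 0)) {t : ℝ} (ht : t ∈ Iio (0 : ℝ)) (x : ℝ³) :
    timeDeriv (ampDrift a) t x + convect (ampDrift a t) (ampDrift a t) x =
      (1 : ℝ) • (Δ (ampDrift a t)) x - gradient (ampDriftPressure a t) x + (0 : ℝ → ℝ³ → ℝ³) t x := by
  have h1 : convect (ampDrift a t) (ampDrift a t) x = 0 := by
    show fderiv ℝ (fun _ : ℝ³ => a t • parasiticDir) x (a t • parasiticDir) = 0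
    simp
  have h2 : Δ (ampDrift a t) x = 0 := by
    show Δ (fun _ : ℝ³ => a t • parasiticDir) x = 0
    rw [InnerProductSpace.laplacian_const]
    rfl
  have h3 : gradient (ampDriftPressure a t) x = (-deriv a t) • parasiticDir := gradient_inner_left_eq _ x
  rw [timeDeriv_ampDrift ha ht x, h1, h2, h3]
  simp [neg_smul]

/-- `div u = 0`. [folklore] -/
theorem isDivFree_ampDrift (a : ℝ → ℝ) (t : ℝ) : VectorCalculus.IsDivFree (ampDrift a t) := by
  intro x
  show VectorCalculus.divergence (fun _ : ℝ³ => a t • parasiticDir) x = 0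
  simp [VectorCalculus.divergence]

/-- **Every smooth drift is a suitable weak solution of Navier–Stokes on the backward slab**
(classical `C²/C¹` solutions are suitable, CKN 1982 §2; KNSS 2009 §1 "parasitic solutions").
[cite: KNSS2009, §1] -/
theorem ampDrift_isSuitable (ha : ContDiffOn ℝ 2 a (Iio 0)) :
    IsSuitableWeakSolutionOn 𝕊 1 0 (ampDrift a) (ampDriftPressure a) :=
  isSuitableWeakSolutionOn_of_contDiffOn (S := Iio 0) isOpen_Iio (by simp)
    (contDiffOn_ampDrift ha) (contDiffOn_ampDriftPressure ha) continuousOn_const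
    (fun _ ht x => momentum_ampDrift ha ht x) (fun t _ => isDivFree_ampDrift a t)

/-- Its classical gradient is a weak spatial gradient on the slab. [folklore] -/
theorem ampDrift_hasWeakSpatialGradientOn (ha : ContDiffOn ℝ 1 a (Iio 0)) :
    HasWeakSpatialGradientOn 𝕊 (ampDrift a) (fun t x => fderiv ℝ (ampDrift a t) x) :=
  hasWeakSpatialGradientOn_of_contDiffOn (S := Iio 0) isOpen_Iio (by simp) (contDiffOn_ampDrift ha)

/-- `‖a(t) e₀‖ = |a(t)|`. [folklore] -/
theorem norm_ampDrift (a : ℝ → ℝ) (t : ℝ) (x : ℝ³) : ‖ampDrift a t x‖ = |a t| := by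
  show ‖a t • parasiticDir‖ = _
  rw [norm_smul, norm_parasiticDir, mul_one, Real.norm_eq_abs]

end Drift

/-- The bump `h(t) = (−t)/(1+t²)`: smooth, `0 < h(t) ≤ −t` for `t < 0`, `h(t)√(−t) ≤ 1`. [folklore] -/
def bump (t : ℝ) : ℝ := -t / (1 + t ^ 2)

/-- `h` is smooth. [folklore] -/
theorem contDiff_bump {n : WithTop ℕ∞} : ContDiff ℝ n bump :=
  contDiff_id.neg.div (contDiff_const.add (contDiff_id.pow 2)) fun t => by positivity

/-- `0 < h(t)` for `t < 0`. [folklore] -/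
theorem bump_pos {t : ℝ} (ht : t < 0) : 0 < bump t := div_pos (by linarith) (by positivity)

/-- `h(t) ≤ −t` for `t < 0`. [folklore] -/
theorem bump_le {t : ℝ} (ht : t < 0) : bump t ≤ -t := by
  unfold bump
  rw [div_le_iff₀ (by positivity)]
  nlinarith [sq_nonneg t]

/-- `h(t) ≤ 1/√(−t)` for `t < 0` (`s^{3/2} ≤ 1 + s²`). [folklore] -/
theorem bump_le_inv_sqrt {t : ℝ} (ht : t < 0) : bump t ≤ 1 / Real.sqrt (-t) := by
  set s := -t with hs
  have hs0 : 0 < s := by linarith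
  have e : bump t = s / (1 + s ^ 2) := by simp [bump, hs]
  rw [e, div_le_div_iff₀ (by positivity) (Real.sqrt_pos.2 hs0), one_mul]
  rcases le_or_gt s 1 with h1 | h1
  · have : Real.sqrt s ≤ 1 := by rw [← Real.sqrt_one]; exact Real.sqrt_le_sqrt h1
    nlinarith [Real.sqrt_nonneg s, sq_nonneg s]
  · have hss : Real.sqrt s ≤ s := by
      have : Real.sqrt s ≤ Real.sqrt (s ^ 2) := Real.sqrt_le_sqrt (by nlinarith)
      rwa [Real.sqrt_sq hs0.le] at this
    nlinarith [Real.sqrt_nonneg s]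

/-- The perturbed parasitic amplitude `b₂(t) = C/√(−t) + h(t)`. [folklore] -/
def pertAmp (C : ℝ) (t : ℝ) : ℝ := parasiticAmp C t + bump t

/-- `b₂` is smooth on `t < 0`. [folklore] -/
theorem contDiffOn_pertAmp (C : ℝ) {n : WithTop ℕ∞} : ContDiffOn ℝ n (pertAmp C) (Iio 0) :=
  (contDiffOn_parasiticAmp C).add contDiff_bump.contDiffOn

/-- `b₂ ≥ 0` on `t < 0` for `C ≥ 0`. [folklore] -/
theorem pertAmp_nonneg {C : ℝ} (hC : 0 ≤ C) {t : ℝ} (ht : t < 0) : 0 ≤ pertAmp C t :=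
  add_nonneg (parasiticAmp_nonneg hC t) (bump_pos ht).le

/-- The perturbed drift has the Type-I RATE with constant `C + 1`. [folklore] -/
theorem pertDrift_hasTypeITimeDecay {C : ℝ} (hC : 0 ≤ C) :
    HasTypeITimeDecay (C + 1) (ampDrift (pertAmp C)) := by
  intro t ht x
  rw [norm_ampDrift, abs_of_nonneg (pertAmp_nonneg hC ht), pertAmp, parasiticAmp, add_div]
  exact add_le_add le_rfl (bump_le_inv_sqrt ht)

/-- The parasitic flow has the rate with the (larger) constant `C + 1` as well. [folklore] -/
theorem parasitic_hasTypeITimeDecay' {C : ℝ} (hC : 0 ≤ C) :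
    HasTypeITimeDecay (C + 1) (parasiticVelocity C) := by
  intro t ht x
  refine (parasitic_hasTypeITimeDecay hC t ht x).trans ?_
  exact div_le_div_of_nonneg_right (by linarith) (Real.sqrt_nonneg _)

/-- MONOTONICITY OF BACKWARD SINGULARITY: a pointwise larger field is singular where the smaller one
is. [folklore] -/
theorem isBackwardSingularPoint_of_norm_le {u v : ℝ → ℝ³ → ℝ³} {z : ℝ × ℝ³}
    (hu : IsBackwardSingularPoint u z) (h : ∀ t x, ‖u t x‖ ≤ ‖v t x‖) :
    IsBackwardSingularPoint v z := fun r hr => by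
  have hle : eLpNorm (uncurry u) ∞ (volume.restrict (parabolicCylinder r z)) ≤
      eLpNorm (uncurry v) ∞ (volume.restrict (parabolicCylinder r z)) :=
    eLpNorm_mono fun w => h w.1 w.2
  rw [hu r hr] at hle
  exact eq_top_iff.2 hle

/-- The perturbed drift is backward-singular at the origin (it dominates the parasitic flow pointwise
on `t < 0`; both are `+∞`-free junk `0`-bounded for `t ≥ 0`, where `√(−t) = 0`). [folklore] -/
theorem pertDrift_isBackwardSingularPoint {C : ℝ} (hC : 0 < C) :
    IsBackwardSingularPoint (ampDrift (pertAmp C)) 0 := by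
  refine isBackwardSingularPoint_of_norm_le (parasitic_isBackwardSingularPoint_zero hC) fun t x => ?_
  rw [parasiticVelocity_eq, norm_ampDrift, norm_ampDrift]
  rcases lt_or_ge t 0 with ht | ht
  · rw [abs_of_nonneg (parasiticAmp_nonneg hC.le t), abs_of_nonneg (pertAmp_nonneg hC.le ht), pertAmp]
    linarith [bump_pos ht]
  · have h0 : parasiticAmp C t = 0 := by
      simp [parasiticAmp, Real.sqrt_eq_zero'.2 (by linarith : -t ≤ 0)]
    simp [pertAmp, h0]

/-- The two drifts have the SAME SCAR: `‖b₁(t) − b₂(t)‖ = h(t) ≤ −t < δ` on `(−δ,0) × K`. [folklore] -/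
theorem sameScar_parasitic_pert (C : ℝ) : SameScar (parasiticVelocity C) (ampDrift (pertAmp C)) := by
  intro K hK _
  have hmeas : ∀ δ : ℝ, MeasurableSet (Ioo (-δ) (0 : ℝ) ×ˢ K) := fun δ =>
    measurableSet_Ioo.prod hK.isClosed.measurableSet
  have hbound : ∀ δ : ℝ, 0 < δ → eLpNorm (uncurry (parasiticVelocity C) - uncurry (ampDrift (pertAmp C))) ⊤
      (volume.restrict (Ioo (-δ) 0 ×ˢ K)) ≤ ENNReal.ofReal δ := by
    intro δ hδ
    rw [eLpNorm_exponent_top]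
    refine eLpNormEssSup_le_of_ae_bound ?_
    filter_upwards [ae_restrict_mem (hmeas δ)] with z hz
    obtain ⟨⟨hz1, hz2⟩, -⟩ := hz
    have e : (uncurry (parasiticVelocity C) - uncurry (ampDrift (pertAmp C))) z = (-bump z.1) • parasiticDir := by
      simp only [Pi.sub_apply, uncurry, parasiticVelocity_eq, ampDrift, pertAmp, ← sub_smul]
      congr 1; ring
    rw [e, norm_smul, norm_parasiticDir, mul_one, norm_neg, Real.norm_of_nonneg (bump_pos hz2).le]
    linarith [bump_le hz2]
  have hup : Tendsto (fun δ : ℝ => ENNReal.ofReal δ) (𝓝[>] 0) (𝓝 0) := by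
    simpa using (ENNReal.tendsto_ofReal (tendsto_id (x := 𝓝 (0 : ℝ)))).mono_left nhdsWithin_le_nhds
  refine tendsto_of_tendsto_of_tendsto_of_le_of_le' tendsto_const_nhds hup
    (Eventually.of_forall fun δ => zero_le) ?_
  filter_upwards [self_mem_nhdsWithin] with δ hδ
  exact hbound δ hδ

/-- The crux with the apex bound weakened to the Type-I RATE and `𝐈 < ∞` dropped (Navier–Stokes, weak
gradients, both singular origins, same scar kept verbatim). -/
def ScarRigidityRateWithoutMorrey : Prop :=
  ∀ (u₁ : ℝ → ℝ³ → ℝ³) (p₁ : ℝ → ℝ³ → ℝ) (G₁ : ℝ → ℝ³ → ℝ³ →L[ℝ] ℝ³)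
    (u₂ : ℝ → ℝ³ → ℝ³) (p₂ : ℝ → ℝ³ → ℝ) (G₂ : ℝ → ℝ³ → ℝ³ →L[ℝ] ℝ³) (C : ℝ),
    IsSuitableWeakSolutionOn 𝕊 1 0 u₁ p₁ → HasWeakSpatialGradientOn 𝕊 u₁ G₁ → HasTypeITimeDecay C u₁ →
    IsSuitableWeakSolutionOn 𝕊 1 0 u₂ p₂ → HasWeakSpatialGradientOn 𝕊 u₂ G₂ → HasTypeITimeDecay C u₂ →
    IsBackwardSingularPoint u₁ 0 → IsBackwardSingularPoint u₂ 0 →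
    SameScar u₁ u₂ → AeEqSlab u₁ u₂

/-- **(B⁺) Spatial decay is load-bearing even for genuinely singular Navier–Stokes pairs.**  The
parasitic flow `(C/√−t) e₀` (`C > 0`) and its perturbation by the bump drift `h(t) e₀` are classical
Navier–Stokes solutions on the open slab (hence suitable weak, with weak gradients), both obey the
Type-I rate with constant `C + 1`, both are backward-singular at the origin (indeed at every final-time
point), they have the same scar, and they differ at EVERY point of the slab.  (KNSS 2009 §1;
Lei–Yang–Yuan 2024 Example 1.2: non-mild flows share final data.)  [cite: KNSS2009, §1] -/
theorem scarRigidity_false_rate_without_morrey : ¬ ScarRigidityRateWithoutMorrey := by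
  intro h
  have hC : (0 : ℝ) < 1 := one_pos
  have hs₁ := parasitic_isSuitableWeakSolutionOn (1 : ℝ)
  have hg₁ := parasitic_hasWeakSpatialGradientOn (1 : ℝ)
  have hs₂ : IsSuitableWeakSolutionOn 𝕊 1 0 (ampDrift (pertAmp 1)) (ampDriftPressure (pertAmp 1)) :=
    ampDrift_isSuitable (contDiffOn_pertAmp 1)
  have hg₂ := ampDrift_hasWeakSpatialGradientOn (contDiffOn_pertAmp 1 (n := 1))
  have hae := h _ _ _ _ _ _ (1 + 1) hs₁ hg₁ (parasitic_hasTypeITimeDecay' hC.le) hs₂ hg₂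
    (pertDrift_hasTypeITimeDecay hC.le) (parasitic_isBackwardSingularPoint_zero hC)
    (pertDrift_isBackwardSingularPoint hC) (sameScar_parasitic_pert 1)
  refine not_aeEq_restrict_of_forall_ne_of_isOpen (isOpen_Iio.prod isOpen_univ)
    ⟨((-1 : ℝ), (0 : ℝ³)), by simp⟩ subset_rfl (fun z hz => ?_) hae
  have ht : z.1 < 0 := (mem_prod.1 hz).1
  have hdir : parasiticDir ≠ 0 := fun h0 => by
    have := norm_parasiticDir; rw [h0, norm_zero] at this; exact zero_ne_one this
  simp only [uncurry, parasiticVelocity_eq, ampDrift]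
  intro heq
  have := smul_left_injective ℝ hdir heq
  simp only [pertAmp] at this
  linarith [bump_pos ht]

/-! ### (B) Decay and singularity dropped together (cycle 1, landed as `UniformDriftBackwardNonuniqueness`) -/

/-- The crux with `𝐈 < ∞`, the apex bound and both singularity hypotheses deleted. -/
def ScarRigidityWithoutDecay : Prop :=
  ∀ (u₁ : ℝ → ℝ³ → ℝ³) (p₁ : ℝ → ℝ³ → ℝ) (G₁ : ℝ → ℝ³ → ℝ³ →L[ℝ] ℝ³)
    (u₂ : ℝ → ℝ³ → ℝ³) (p₂ : ℝ → ℝ³ → ℝ) (G₂ : ℝ → ℝ³ → ℝ³ →L[ℝ] ℝ³),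
    IsSuitableWeakSolutionOn 𝕊 1 0 u₁ p₁ → HasWeakSpatialGradientOn 𝕊 u₁ G₁ →
    IsSuitableWeakSolutionOn 𝕊 1 0 u₂ p₂ → HasWeakSpatialGradientOn 𝕊 u₂ G₂ →
    SameScar u₁ u₂ → AeEqSlab u₁ u₂

/-- **(B)** backward uniqueness from the scar FAILS on the whole slab without decay: `0` vs the Galilean
drift `t e` (Lei–Yang–Yuan 2024, Example 1.2).  [cite: LeiYangYuan2024, Example 1.2] -/
theorem scarRigidity_false_without_decay : ¬ ScarRigidityWithoutDecay := by
  intro h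
  obtain ⟨u₁, u₂, p₁, p₂, G₁, G₂, hs₁, hg₁, hs₂, hg₂, hscar, hne⟩ := exists_sameScar_not_aeEq_slab
  exact hne (h u₁ p₁ G₁ u₂ p₂ G₂ hs₁ hg₁ hs₂ hg₂ hscar)

/-! ### (D) Locality (cycle 1, landed): the crux is NOT a local statement -/

/-- LOCAL FORM of the crux on the parabolic cylinder `Q_R(0,0)`: suitable weak solutions there with the
apex bound there and the same scar coincide a.e. there. -/
def ScarRigidityOnCylinder (R : ℝ) : Prop :=
  ∀ (u₁ : ℝ → ℝ³ → ℝ³) (p₁ : ℝ → ℝ³ → ℝ) (G₁ : ℝ → ℝ³ → ℝ³ →L[ℝ] ℝ³)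
    (u₂ : ℝ → ℝ³ → ℝ³) (p₂ : ℝ → ℝ³ → ℝ) (G₂ : ℝ → ℝ³ → ℝ³ →L[ℝ] ℝ³) (C : ℝ),
    IsSuitableWeakSolutionOn (parabolicCylinderOpens R (0 : ℝ × ℝ³)) 1 0 u₁ p₁ →
    HasWeakSpatialGradientOn (parabolicCylinderOpens R (0 : ℝ × ℝ³)) u₁ G₁ →
    (∀ z ∈ parabolicCylinder R (0 : ℝ × ℝ³), ‖u₁ z.1 z.2‖ ≤ C / (‖z.2‖ + Real.sqrt (-z.1))) →
    IsSuitableWeakSolutionOn (parabolicCylinderOpens R (0 : ℝ × ℝ³)) 1 0 u₂ p₂ →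
    HasWeakSpatialGradientOn (parabolicCylinderOpens R (0 : ℝ × ℝ³)) u₂ G₂ →
    (∀ z ∈ parabolicCylinder R (0 : ℝ × ℝ³), ‖u₂ z.1 z.2‖ ≤ C / (‖z.2‖ + Real.sqrt (-z.1))) →
    SameScar u₁ u₂ →
    uncurry u₁ =ᵐ[volume.restrict (parabolicCylinder R (0 : ℝ × ℝ³))] uncurry u₂

/-- **(D)** the local form fails on EVERY cylinder (`0` vs the drift `t e`, apex constant `2R³`).
[folklore] -/
theorem scarRigidity_false_local {R : ℝ} (hR : 0 < R) : ¬ ScarRigidityOnCylinder R := by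
  intro h
  obtain ⟨C, u₁, u₂, p₁, p₂, G₁, G₂, hs₁, hg₁, hd₁, hs₂, hg₂, hd₂, hscar, hne⟩ :=
    exists_sameScar_typeI_not_aeEq_cylinder hR
  exact hne (h u₁ p₁ G₁ u₂ p₂ G₂ C hs₁ hg₁ hd₁ hs₂ hg₂ hd₂ hscar)

/-! ### (C), (C″) The parabolic core is load-bearing (cycle 1, landed) -/

/-- EXTERIOR FORM of the crux on the parabolic exterior `Ω_R = {R√(−t) < ‖x‖}` (`{|y| > R} × ℝ_s` in
similarity variables) at apex constant `C`. -/
def ScarRigidityOnParabolicExterior (R C : ℝ) : Prop :=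
  ∀ (u₁ : ℝ → ℝ³ → ℝ³) (p₁ : ℝ → ℝ³ → ℝ) (G₁ : ℝ → ℝ³ → ℝ³ →L[ℝ] ℝ³)
    (u₂ : ℝ → ℝ³ → ℝ³) (p₂ : ℝ → ℝ³ → ℝ) (G₂ : ℝ → ℝ³ → ℝ³ →L[ℝ] ℝ³),
    IsSuitableWeakSolutionOn (parabolicExteriorOpens R) 1 0 u₁ p₁ →
    HasWeakSpatialGradientOn (parabolicExteriorOpens R) u₁ G₁ →
    (∀ z ∈ parabolicExterior R, ‖u₁ z.1 z.2‖ ≤ C / (‖z.2‖ + Real.sqrt (-z.1))) →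
    IsSuitableWeakSolutionOn (parabolicExteriorOpens R) 1 0 u₂ p₂ →
    HasWeakSpatialGradientOn (parabolicExteriorOpens R) u₂ G₂ →
    (∀ z ∈ parabolicExterior R, ‖u₂ z.1 z.2‖ ≤ C / (‖z.2‖ + Real.sqrt (-z.1))) →
    SameScar u₁ u₂ →
    uncurry u₁ =ᵐ[volume.restrict (parabolicExterior R)] uncurry u₂

/-- **(C)** the exterior form fails for EVERY `R ≥ 1` and EVERY `C > 0` (`0` vs the potential flow
`C√(−t)∇Γ(x)` = stationary similarity mode `W = C∇Γ(y)`; Serrin 1962).  No smallness threshold off the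
core, in contrast with the whole-slab crux whose `C < ε₀` slices are vacuous. [cite: Serrin1962] -/
theorem scarRigidity_false_parabolicExterior {R C : ℝ} (hR : 1 ≤ R) (hC : 0 < C) :
    ¬ ScarRigidityOnParabolicExterior R C := by
  intro h
  obtain ⟨u₁, u₂, p₁, p₂, G₁, G₂, hs₁, hg₁, hd₁, hs₂, hg₂, hd₂, hscar, hne⟩ :=
    exists_sameScar_typeI_not_aeEq_parabolicExterior hR hC
  exact hne (h u₁ p₁ G₁ u₂ p₂ G₂ hs₁ hg₁ hd₁ hs₂ hg₂ hd₂ hscar)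

/-- EXTERIOR FORM INSIDE THE DECAY CLASS `‖u‖ ≤ C(−t)/(π‖x‖³)` (similarity `|W| ≤ C/(π|y|³)`, the rate
the route's foreseen `DifferenceDecay` step would deliver). -/
def ScarRigidityOnParabolicExteriorCubicDecay (R C : ℝ) : Prop :=
  ∀ (u₁ : ℝ → ℝ³ → ℝ³) (p₁ : ℝ → ℝ³ → ℝ) (u₂ : ℝ → ℝ³ → ℝ³) (p₂ : ℝ → ℝ³ → ℝ),
    IsSuitableWeakSolutionOn (parabolicExteriorOpens R) 1 0 u₁ p₁ →
    (∀ z ∈ parabolicExterior R, ‖u₁ z.1 z.2‖ ≤ C / (‖z.2‖ + Real.sqrt (-z.1))) →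
    (∀ z ∈ parabolicExterior R, ‖u₁ z.1 z.2‖ ≤ C / (Real.pi * ‖z.2‖ ^ 3) * (-z.1)) →
    IsSuitableWeakSolutionOn (parabolicExteriorOpens R) 1 0 u₂ p₂ →
    (∀ z ∈ parabolicExterior R, ‖u₂ z.1 z.2‖ ≤ C / (‖z.2‖ + Real.sqrt (-z.1))) →
    (∀ z ∈ parabolicExterior R, ‖u₂ z.1 z.2‖ ≤ C / (Real.pi * ‖z.2‖ ^ 3) * (-z.1)) →
    SameScar u₁ u₂ →
    uncurry u₁ =ᵐ[volume.restrict (parabolicExterior R)] uncurry u₂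

/-- **(C″)** the exterior form fails even in the cubic decay class: `0` vs the dipole-moment flow
`C(−t)∇(∂ₑΓ)(x)` (the `l = 1` Serrin mode; on paper every `2^l`-pole `(−t)^{(l+1)/2}∇(r^{−l−1}Y_lm)`).
Hence NO decay-rate hypothesis repairs an exterior Rellich lemma. [cite: Serrin1962] -/
theorem scarRigidity_false_parabolicExterior_cubicDecay {R C : ℝ} (hR : 1 ≤ R) (hC : 0 < C) :
    ¬ ScarRigidityOnParabolicExteriorCubicDecay R C := by
  intro h
  obtain ⟨e, _, hs₁, hs₂, hd, hd', hscar, hne⟩ :=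
    exists_sameScar_typeI_cubicDecay_not_aeEq_parabolicExterior hR hC
  have hz1 : ∀ z ∈ parabolicExterior R, ‖quadFlow 0 e z.1 z.2‖ ≤ C / (‖z.2‖ + Real.sqrt (-z.1)) := by
    intro z hz
    refine le_trans ?_ (hd z hz)
    simp [quadFlow_zero]
  have hz2 : ∀ z ∈ parabolicExterior R, ‖quadFlow 0 e z.1 z.2‖ ≤ C / (Real.pi * ‖z.2‖ ^ 3) * (-z.1) := by
    intro z hz
    refine le_trans ?_ (hd' z hz)
    simp [quadFlow_zero]
  exact hne (h _ _ _ _ hs₁ hz1 hz2 hs₂ hd hd' hscar)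

/-! ## §4 The linear mechanism (paper) -/

/-- WHY IT RESISTS AT THE LINEAR LEVEL — see the module docblock §4.  In Leray variables
`y = x/√(−t)`, `s = −log(−t)` the difference `W` of two apex profiles is an eternal, two-sided bounded
(`|W| ≤ 2C/(…)`), divergence-free solution of `∂ₛW = ΔW − ½y·∇W − ½W − U₁·∇W − W·∇U₂ − ∇Π`, and
"same scar" reads `W = o(1/|y|)` along `|y| ~ e^{s/2}`.  Far-field bookkeeping of `e^{λs}` modes:
the leading balance at infinity is `−½(y·∇W + W) + ∇Π = λW`, whose solutions are (i) the CALORIC slow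
branch `r^{−1−2λ}×(angular)` with scar exactly `|x|^{−1−2λ}Y_lm` (time-independent, never zero) and
(ii) POTENTIAL multipoles `∇(r^{−l−1}Y_lm)` (zero scar; exact exterior solutions for every amplitude
`a(s)`, §2 (C)); corrections are forced order by order with no obstruction.  Two-sided boundedness ⇒
`Re λ = 0`; zero scar ⇒ all caloric coefficients vanish.  For `U = 0` with the core: the vorticity obeys
`∂ₛΩ = (L − 1)Ω`, `L = Δ − ½y·∇` self-adjoint on `L²(e^{−|y|²/4})` with spectrum `{−k/2}`, so a bounded
eternal `Ω` is `0`, `W(s)` is harmonic and bounded, i.e. a constant `c(s)` (the parasitic mode), and any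
decay at infinity gives `W = 0` — scar-free rigidity by the spectral gap.  The scar is the deciding datum
only where the background carries neutral modes; a zero-scar neutral mode is a codimension-∞ event
(one real condition per `(l,m)`), generically absent, constructible only by inverse design of the
background.  The symmetry modes are consistent with the crux: time translation `λ = 1` (`U + y·∇U`,
zero scar, not bounded as `s → +∞`), space translation `λ = ½`, rotations / scaling `λ = 0` with scars
`= the infinitesimal change of the profile's own scar` (zero iff the scar is symmetric — then the crux
hands over to the Liouville kills).  Recorded as guidance; nothing is claimed in Lean. -/
theorem linearMechanism_note : True := trivial


/-! ## §7 (cycle 3, NEW) An explicit ZERO-SCAR NEUTRAL MODE of the linearised Leray operator with a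
Type-I-critical potential — the crux is FALSE at the size/inequality level

Everything below is kernel-checked (also proposed to the tree as `Theorems/ScarRigidity/Negative/
NeutralModeProfile|NeutralModeIdentity|NeutralMode.lean`).  Construction (similarity variables, unit vector
`m`, `σ = |y|²`, `ζ = (1+σ)^{-1/2}`, Plummer potential `G = ζ(|y|²)`):
`W = ∇(∂ₘG) − (ΔG)m = ζ⁵[(2−σ)m + 3(m·y)y]` (= `curl(ζ³ m×y)`; far field = dipole POTENTIAL flow, zero
scar; `div W = 0`; `|W|² ≤ 4ζ⁶`; `W(0) = 2m`); abstractly `LW − ∇Π₀ = ρ(σ)m` with `L = Δ − ½y·∇ − ½`,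
`Π₀ = ∂ₘΔG − ½y·∇∂ₘG`, `ρ = ½(y·∇q+q) − Δq`, `q = ΔG = −3ζ⁵`; then `Π = Π₀ + ρ(m·y)` leaves
`LW − ∇Π = −2ρ′(σ)(m·y)y`, and since `y·W = 2(m·y)ζ³` this is `M W` with the RATIONAL potential
`M = θ(σ) y⊗y`, `θ = (15/4)(4σ²+57σ−73)/(1+σ)⁴` (`sup(1+σ)|M| ≈ 28.4 ≤ 30`, `|M| ~ 15/|y|²`).  Hence
`ΔW − ½(y·∇)W − ½W − MW − ∇Π = 0` (`neutral_identity`).  In physical variables (tree `lerayBackward`,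
`a = ½`, `T = 0`): `w = (−t)^{-1/2}W(x/√−t)` solves `∂ₜw − Δw + 𝓜w + ∇π = 0`, `div w = 0`,
`|𝓜| ≤ 30/((−t)+|x|²) ≤ 60/(|x|+√−t)²`, `|w|² ≤ 4(−t)²/((−t)+|x|²)³` (apex Type-I `|w| ≤ 2√2/(|x|+√−t)`,
cubic flatness `|w| ≤ 2(−t)/|x|³` ⇒ ZERO SCAR, finite energy `‖w(t)‖₂ ~ (−t)^{1/4}`), `w(t,0) = 2m/√(−t)`
(singular apex).  Refuted: `NeutralModeRigidity 30`, `LinearisedScarRigidity 30` (the eternal `s`-form of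
the crux's linearised statement with `W·∇Ū` replaced by a general potential of the same size and the drift
dropped), `DifferenceInequalityRigidity 30` (physical variables, whole slab). -/

/-! ### §7.1 The radial profile layer: `ζ(σ) = (1+σ)^{-1/2}` and polynomial multiples of its powers -/

/-- `ζ(σ) = 1/√(1+σ)` — with `σ = ‖y‖²` this is the inverse Japanese bracket `⟨y⟩⁻¹`; `ζ²(1+σ) = 1`. -/
def brInv (σ : ℝ) : ℝ := (Real.sqrt (1 + σ))⁻¹

/-- `1 + σ > 0` for `σ > -1`. [folklore] -/
theorem one_add_pos {σ : ℝ} (hσ : -1 < σ) : 0 < 1 + σ := by linarith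

/-- `ζ(σ) > 0` for `σ > -1`. [folklore] -/
theorem brInv_pos {σ : ℝ} (hσ : -1 < σ) : 0 < brInv σ :=
  inv_pos.2 (Real.sqrt_pos.2 (one_add_pos hσ))

/-- The defining algebraic relation `ζ(σ)² (1+σ) = 1`. -/
theorem brInv_sq_mul {σ : ℝ} (hσ : -1 < σ) : brInv σ ^ 2 * (1 + σ) = 1 := by
  unfold brInv
  rw [inv_pow, Real.sq_sqrt (one_add_pos hσ).le, inv_mul_cancel₀ (one_add_pos hσ).ne']

/-- `ζ(0) = 1`. [folklore] -/
theorem brInv_zero : brInv 0 = 1 := by simp [brInv]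

/-- Power bookkeeping: `ζ^k = ζ^(k+2) (1+σ)`. -/
theorem brInv_pow_eq {σ : ℝ} (hσ : -1 < σ) (k : ℕ) :
    brInv σ ^ k = brInv σ ^ (k + 2) * (1 + σ) := by
  rw [pow_add, mul_assoc, brInv_sq_mul hσ, mul_one]

/-- `ζ' = -½ ζ³` on `σ > -1`. -/
theorem hasDerivAt_brInv {σ : ℝ} (hσ : -1 < σ) :
    HasDerivAt brInv (-(1 / 2) * brInv σ ^ 3) σ := by
  have hne1 : (1 : ℝ) + σ ≠ 0 := (one_add_pos hσ).ne'
  have h1 : HasDerivAt (fun σ : ℝ => 1 + σ) 1 σ := (hasDerivAt_id σ).const_add 1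
  have h2 : HasDerivAt (fun σ : ℝ => Real.sqrt (1 + σ)) (1 / (2 * Real.sqrt (1 + σ))) σ := h1.sqrt hne1
  have hsq : Real.sqrt (1 + σ) ≠ 0 := (Real.sqrt_pos.2 (one_add_pos hσ)).ne'
  have h3 := h2.inv hsq
  refine h3.congr_deriv ?_
  unfold brInv
  have hs2 : Real.sqrt (1 + σ) ^ 2 = 1 + σ := Real.sq_sqrt (one_add_pos hσ).le
  have hs3 : Real.sqrt (1 + σ) ^ 3 = (1 + σ) * Real.sqrt (1 + σ) := by rw [pow_succ, hs2]
  rw [hs2, inv_pow, hs3]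
  field_simp

/-- Derivative of `p(σ) ζ(σ)^k`: `p' ζ^k - (k/2) p ζ^(k+2)`. -/
theorem hasDerivAt_mul_brInv_pow {p : ℝ → ℝ} {p' σ : ℝ} (hσ : -1 < σ) (hp : HasDerivAt p p' σ)
    (k : ℕ) (hk : 1 ≤ k) :
    HasDerivAt (fun σ => p σ * brInv σ ^ k)
      (p' * brInv σ ^ k - (k / 2) * p σ * brInv σ ^ (k + 2)) σ := by
  have hz := hasDerivAt_brInv hσ
  have hpow : HasDerivAt (fun σ => brInv σ ^ k) ((k : ℝ) * brInv σ ^ (k - 1) * (-(1 / 2) * brInv σ ^ 3)) σ :=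
    hz.pow k
  refine (hp.mul hpow).congr_deriv ?_
  obtain ⟨j, rfl⟩ := Nat.exists_eq_add_of_le hk
  simp only [Nat.add_sub_cancel_left]
  ring

/-! ### §7.2 The profile functions (explicit; Plummer potential `G = ζ(|y|²)`) -/

/-- `A(σ) = (2-σ) ζ⁵`: the `m`-coefficient of `W`. -/
def modeA (σ : ℝ) : ℝ := (2 - σ) * brInv σ ^ 5
/-- `A'`. -/
def modeA₁ (σ : ℝ) : ℝ := (3 / 2 * σ - 6) * brInv σ ^ 7
/-- `A''`. -/
def modeA₂ (σ : ℝ) : ℝ := (45 / 2 - 15 / 4 * σ) * brInv σ ^ 9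
/-- `B(σ) = 3 ζ⁵`: the `(m·y) y`-coefficient of `W`. -/
def modeB (σ : ℝ) : ℝ := 3 * brInv σ ^ 5
/-- `B'`. -/
def modeB₁ (σ : ℝ) : ℝ := -(15 / 2) * brInv σ ^ 7
/-- `B''`. -/
def modeB₂ (σ : ℝ) : ℝ := 105 / 4 * brInv σ ^ 9
/-- `ϖ(σ)`: the pressure is `Π = ϖ(|y|²) (m·y)`. -/
def modeP (σ : ℝ) : ℝ := (-σ ^ 3 + 9 / 2 * σ ^ 2 + 159 / 2 * σ - 31) * brInv σ ^ 9
/-- `ϖ'`. -/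
def modeP₁ (σ : ℝ) : ℝ := (3 / 2 * σ ^ 3 - 57 / 4 * σ ^ 2 - 1077 / 4 * σ + 219) * brInv σ ^ 11
/-- `θ(σ) = (15/4)(4σ²+57σ-73) ζ⁸`: the potential is `M = θ(|y|²) y ⊗ y` (RATIONAL in `y`). -/
def modeT (σ : ℝ) : ℝ := 15 / 4 * (4 * σ ^ 2 + 57 * σ - 73) * brInv σ ^ 8

/-- `A' = A₁` on `σ > -1`. [folklore] -/
theorem hasDerivAt_modeA {σ : ℝ} (hσ : -1 < σ) : HasDerivAt modeA (modeA₁ σ) σ := by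
  have hp : HasDerivAt (fun σ : ℝ => 2 - σ) (-1) σ := by
    simpa using (hasDerivAt_id σ).const_sub 2
  refine (hasDerivAt_mul_brInv_pow hσ hp 5 (by norm_num)).congr_deriv ?_
  rw [modeA₁, brInv_pow_eq hσ 5]
  push_cast
  ring

/-- `A₁' = A₂` on `σ > -1`. [folklore] -/
theorem hasDerivAt_modeA₁ {σ : ℝ} (hσ : -1 < σ) : HasDerivAt modeA₁ (modeA₂ σ) σ := by
  have hp : HasDerivAt (fun σ : ℝ => 3 / 2 * σ - 6) (3 / 2) σ := by
    simpa using ((hasDerivAt_id σ).const_mul (3 / 2 : ℝ)).sub_const 6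
  refine (hasDerivAt_mul_brInv_pow hσ hp 7 (by norm_num)).congr_deriv ?_
  rw [modeA₂, brInv_pow_eq hσ 7]
  push_cast
  ring

/-- `B' = B₁` on `σ > -1`. [folklore] -/
theorem hasDerivAt_modeB {σ : ℝ} (hσ : -1 < σ) : HasDerivAt modeB (modeB₁ σ) σ := by
  have hp : HasDerivAt (fun _ : ℝ => (3 : ℝ)) 0 σ := hasDerivAt_const σ 3
  refine (hasDerivAt_mul_brInv_pow hσ hp 5 (by norm_num)).congr_deriv ?_
  rw [modeB₁]
  push_cast
  ring

/-- `B₁' = B₂` on `σ > -1`. [folklore] -/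
theorem hasDerivAt_modeB₁ {σ : ℝ} (hσ : -1 < σ) : HasDerivAt modeB₁ (modeB₂ σ) σ := by
  have hp : HasDerivAt (fun _ : ℝ => (-(15 / 2) : ℝ)) 0 σ := hasDerivAt_const σ _
  refine (hasDerivAt_mul_brInv_pow hσ hp 7 (by norm_num)).congr_deriv ?_
  rw [modeB₂]
  push_cast
  ring

/-- `ϖ' = ϖ₁` on `σ > -1`. [folklore] -/
theorem hasDerivAt_modeP {σ : ℝ} (hσ : -1 < σ) : HasDerivAt modeP (modeP₁ σ) σ := by
  have hp : HasDerivAt (fun σ : ℝ => -σ ^ 3 + 9 / 2 * σ ^ 2 + 159 / 2 * σ - 31)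
      (-(3 * σ ^ 2) + 9 / 2 * (2 * σ) + 159 / 2) σ := by
    have h3 : HasDerivAt (fun σ : ℝ => σ ^ 3) (3 * σ ^ 2) σ := by simpa using hasDerivAt_pow 3 σ
    have h2 : HasDerivAt (fun σ : ℝ => σ ^ 2) (2 * σ) σ := by simpa using hasDerivAt_pow 2 σ
    simpa using ((h3.neg.add (h2.const_mul (9 / 2 : ℝ))).add
      ((hasDerivAt_id σ).const_mul (159 / 2 : ℝ))).sub_const 31
  refine (hasDerivAt_mul_brInv_pow hσ hp 9 (by norm_num)).congr_deriv ?_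
  rw [modeP₁, brInv_pow_eq hσ 9]
  push_cast
  ring


/-! ### §7.3 The fields: velocity `W`, pressure `Π`, potential `M` (similarity variables) -/

/-- THE NEUTRAL MODE `W(y) = A(|y|²) m + B(|y|²) (m·y) y = ⟨y⟩⁻⁵[(2-|y|²)m + 3(m·y)y]`
(`= ∇(∂ₘG) − (ΔG)m = curl(⟨y⟩⁻³ m × y)` for the Plummer potential `G = ⟨y⟩⁻¹`). -/
def neutralW (m : ℝ³) (y : ℝ³) : ℝ³ := modeA (‖y‖ ^ 2) • m + (modeB (‖y‖ ^ 2) * ⟪m, y⟫) • y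

/-- ITS PRESSURE `Π(y) = ϖ(|y|²) (m·y)`. -/
def neutralP (m : ℝ³) (y : ℝ³) : ℝ := modeP (‖y‖ ^ 2) * ⟪m, y⟫

/-- THE CRITICAL MATRIX POTENTIAL `M(y) = θ(|y|²) y ⊗ y` (`M(y)v = θ ⟨y,v⟩ y`; `|M| ~ 15/|y|²`). -/
def neutralM (y : ℝ³) : ℝ³ →L[ℝ] ℝ³ := modeT (‖y‖ ^ 2) • (innerSL ℝ y).smulRight y

/-- `M(y)v = θ(|y|²)⟨y,v⟩ y`. [folklore] -/
theorem neutralM_apply (y v : ℝ³) : neutralM y v = (modeT (‖y‖ ^ 2) * ⟪y, v⟫) • y := by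
  simp [neutralM, mul_smul]

/-! ### §7.4 Smoothness -/

/-- `|y|² > -1`: the profile layer applies at every `σ = |y|²`. [folklore] -/
theorem neg_one_lt_norm_sq (y : ℝ³) : (-1 : ℝ) < ‖y‖ ^ 2 := by
  have := sq_nonneg ‖y‖; linarith

/-- `y ↦ ζ(|y|²) = (1+|y|²)^{-1/2}` is smooth on `ℝ³`. [folklore] -/
theorem contDiff_brInv_comp {n : ℕ∞} : ContDiff ℝ n (fun y : ℝ³ => brInv (‖y‖ ^ 2)) := by
  unfold brInv
  have h1 : ContDiff ℝ n (fun y : ℝ³ => (1 : ℝ) + ‖y‖ ^ 2) := contDiff_const.add (contDiff_norm_sq ℝ)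
  have hne : ∀ y : ℝ³, (1 : ℝ) + ‖y‖ ^ 2 ≠ 0 := fun y => by positivity
  have h2 : ContDiff ℝ n (fun y : ℝ³ => Real.sqrt (1 + ‖y‖ ^ 2)) := h1.sqrt hne
  exact h2.inv fun y => (Real.sqrt_pos.2 (by positivity)).ne'

/-- `y ↦ A(|y|²)` is smooth. [folklore] -/
theorem contDiff_modeA_comp {n : ℕ∞} : ContDiff ℝ n (fun y : ℝ³ => modeA (‖y‖ ^ 2)) := by
  unfold modeA
  exact (contDiff_const.sub (contDiff_norm_sq ℝ)).mul (contDiff_brInv_comp.pow 5)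

/-- `y ↦ B(|y|²)` is smooth. [folklore] -/
theorem contDiff_modeB_comp {n : ℕ∞} : ContDiff ℝ n (fun y : ℝ³ => modeB (‖y‖ ^ 2)) := by
  unfold modeB
  exact contDiff_const.mul (contDiff_brInv_comp.pow 5)

/-- `y ↦ ϖ(|y|²)` is smooth. [folklore] -/
theorem contDiff_modeP_comp {n : ℕ∞} : ContDiff ℝ n (fun y : ℝ³ => modeP (‖y‖ ^ 2)) := by
  unfold modeP
  refine ContDiff.mul ?_ (contDiff_brInv_comp.pow 9)
  exact ((((contDiff_norm_sq ℝ).pow 3).neg.add (contDiff_const.mul ((contDiff_norm_sq ℝ).pow 2))).add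
    (contDiff_const.mul (contDiff_norm_sq ℝ))).sub contDiff_const

/-- `y ↦ ⟨m, y⟩` is smooth. [folklore] -/
theorem contDiff_inner_const (m : ℝ³) {n : ℕ∞} : ContDiff ℝ n (fun y : ℝ³ => ⟪m, y⟫) :=
  ContDiff.inner ℝ contDiff_const contDiff_id

/-- The scalar `φ(y) = B(|y|²)(m·y)`. -/
theorem contDiff_phi (m : ℝ³) {n : ℕ∞} :
    ContDiff ℝ n (fun y : ℝ³ => modeB (‖y‖ ^ 2) * ⟪m, y⟫) :=
  contDiff_modeB_comp.mul (contDiff_inner_const m)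

/-- `W` is smooth. [folklore] -/
theorem contDiff_neutralW (m : ℝ³) {n : ℕ∞} : ContDiff ℝ n (neutralW m) := by
  unfold neutralW
  exact (contDiff_modeA_comp.smul contDiff_const).add ((contDiff_phi m).smul contDiff_id)

/-- `Π` is smooth. [folklore] -/
theorem contDiff_neutralP (m : ℝ³) {n : ℕ∞} : ContDiff ℝ n (neutralP m) := by
  unfold neutralP
  exact contDiff_modeP_comp.mul (contDiff_inner_const m)

/-! ### §7.5 Pointwise calculus -/

section Calculus

variable (m : ℝ³)

/-- First derivative of a radial profile composed with `|y|²`. -/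
theorem hasFDerivAt_radial {g g₁ : ℝ → ℝ} (hg : ∀ σ : ℝ, -1 < σ → HasDerivAt g (g₁ σ) σ) (y : ℝ³) :
    HasFDerivAt (fun w : ℝ³ => g (‖w‖ ^ 2)) ((2 * g₁ (‖y‖ ^ 2)) • (innerSL ℝ y : ℝ³ →L[ℝ] ℝ)) y :=
  hasFDerivAt_comp_norm_sq (hg _ (neg_one_lt_norm_sq y))

/-- Laplacian of a radial profile composed with `|y|²` in dimension 3: `4σ g'' + 6 g'`. -/
theorem laplacian_radial {g g₁ g₂ : ℝ → ℝ} (hg : ∀ σ : ℝ, -1 < σ → HasDerivAt g (g₁ σ) σ)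
    (hg₁ : ∀ σ : ℝ, -1 < σ → HasDerivAt g₁ (g₂ σ) σ) (y : ℝ³) :
    (Δ (fun w : ℝ³ => g (‖w‖ ^ 2))) y = 4 * g₂ (‖y‖ ^ 2) * ‖y‖ ^ 2 + 6 * g₁ (‖y‖ ^ 2) := by
  have h := laplacian_comp_norm_sq (E := ℝ³) isOpen_Ioi (fun σ hσ => hg σ hσ) (neg_one_lt_norm_sq y)
    (hg₁ _ (neg_one_lt_norm_sq y))
  rw [h, finrank_euclideanSpace_fin]
  push_cast
  ring

/-- Derivative of `φ(y) = g(|y|²)(m·y)`. -/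
theorem hasFDerivAt_radial_mul_inner {g g₁ : ℝ → ℝ} (hg : ∀ σ : ℝ, -1 < σ → HasDerivAt g (g₁ σ) σ)
    (y : ℝ³) :
    HasFDerivAt (fun w : ℝ³ => g (‖w‖ ^ 2) * ⟪m, w⟫)
      (g (‖y‖ ^ 2) • (innerSL ℝ m : ℝ³ →L[ℝ] ℝ) +
        ⟪m, y⟫ • ((2 * g₁ (‖y‖ ^ 2)) • (innerSL ℝ y : ℝ³ →L[ℝ] ℝ))) y :=
  (hasFDerivAt_radial hg y).fun_mul (innerSL ℝ m).hasFDerivAt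

/-- Gradient of `φ(y) = g(|y|²)(m·y)`: `g m + 2 g' (m·y) y`. -/
theorem gradient_radial_mul_inner {g g₁ : ℝ → ℝ} (hg : ∀ σ : ℝ, -1 < σ → HasDerivAt g (g₁ σ) σ)
    (y : ℝ³) :
    gradient (fun w : ℝ³ => g (‖w‖ ^ 2) * ⟪m, w⟫) y =
      g (‖y‖ ^ 2) • m + (2 * g₁ (‖y‖ ^ 2) * ⟪m, y⟫) • y := by
  have hF := hasFDerivAt_radial_mul_inner m hg y
  have hv : g (‖y‖ ^ 2) • (innerSL ℝ m : ℝ³ →L[ℝ] ℝ) +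
        ⟪m, y⟫ • ((2 * g₁ (‖y‖ ^ 2)) • (innerSL ℝ y : ℝ³ →L[ℝ] ℝ)) =
      InnerProductSpace.toDual ℝ ℝ³ (g (‖y‖ ^ 2) • m + (2 * g₁ (‖y‖ ^ 2) * ⟪m, y⟫) • y) := by
    ext w
    simp only [add_apply, smul_apply,
      innerSL_apply_apply, smul_eq_mul, InnerProductSpace.toDual_apply_apply, inner_add_left, real_inner_smul_left]
    ring
  rw [hv] at hF
  exact (hasGradientAt_iff_hasFDerivAt.2 hF).gradient

/-- The Laplacian of a continuous linear map vanishes. -/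
theorem laplacian_clm {F : Type*} [NormedAddCommGroup F] [InnerProductSpace ℝ F] (l : ℝ³ →L[ℝ] F)
    (y : ℝ³) : (Δ (fun w : ℝ³ => l w)) y = 0 := by
  rw [laplacian_eq_sum_fderiv_fderiv (stdOrthonormalBasis ℝ ℝ³) (l.contDiff.of_le le_top) y]
  refine Finset.sum_eq_zero fun i _ => ?_
  have h1 : (fun w : ℝ³ => fderiv ℝ (fun w : ℝ³ => l w) w (stdOrthonormalBasis ℝ ℝ³ i)) =
      fun _ => l (stdOrthonormalBasis ℝ ℝ³ i) := by
    funext w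
    rw [show (fun w : ℝ³ => l w) = l from rfl, l.fderiv]
  rw [h1]
  simp

/-- Laplacian of `φ(y) = g(|y|²)(m·y)`: `(4σ g'' + 10 g')(m·y)`. -/
theorem laplacian_radial_mul_inner {g g₁ g₂ : ℝ → ℝ} (hg : ∀ σ : ℝ, -1 < σ → HasDerivAt g (g₁ σ) σ)
    (hg₁ : ∀ σ : ℝ, -1 < σ → HasDerivAt g₁ (g₂ σ) σ) (hgc : ContDiff ℝ 2 (fun w : ℝ³ => g (‖w‖ ^ 2)))
    (y : ℝ³) :
    (Δ (fun w : ℝ³ => g (‖w‖ ^ 2) * ⟪m, w⟫)) y =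
      (4 * g₂ (‖y‖ ^ 2) * ‖y‖ ^ 2 + 10 * g₁ (‖y‖ ^ 2)) * ⟪m, y⟫ := by
  set b := stdOrthonormalBasis ℝ ℝ³ with hb
  have hl : ContDiff ℝ 2 (fun w : ℝ³ => ⟪m, w⟫) := contDiff_inner_const m
  rw [laplacian_mul_eq b hgc hl y, laplacian_radial hg hg₁ y]
  have h0 : (Δ (fun w : ℝ³ => ⟪m, w⟫)) y = 0 := laplacian_clm (innerSL ℝ m) y
  rw [h0, mul_zero, zero_add]
  have h1 : ∀ i, fderiv ℝ (fun w : ℝ³ => g (‖w‖ ^ 2)) y (b i) = 2 * g₁ (‖y‖ ^ 2) * ⟪y, b i⟫ := fun i => by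
    rw [(hasFDerivAt_radial hg y).fderiv]; simp
  have h2 : ∀ i, fderiv ℝ (fun w : ℝ³ => ⟪m, w⟫) y (b i) = ⟪b i, m⟫ := fun i => by
    rw [show (fun w : ℝ³ => ⟪m, w⟫) = (innerSL ℝ m : ℝ³ →L[ℝ] ℝ) from rfl, (innerSL ℝ m).fderiv,
      innerSL_apply_apply, real_inner_comm]
  simp_rw [h1, h2]
  have h3 : ∑ i, 2 * g₁ (‖y‖ ^ 2) * ⟪y, b i⟫ * ⟪b i, m⟫ = 2 * g₁ (‖y‖ ^ 2) * ⟪y, m⟫ := by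
    rw [← b.sum_inner_mul_inner y m, Finset.mul_sum]
    exact Finset.sum_congr rfl fun i _ => by ring
  rw [h3, real_inner_comm m y]
  ring

end Calculus


/-! ### §7.6 The four pointwise formulas -/

section Formulas

variable (m : ℝ³)

/-- `A' = A₁` (quantified form for the radial-calculus lemmas). [folklore] -/
theorem modeA_deriv : ∀ σ : ℝ, -1 < σ → HasDerivAt modeA (modeA₁ σ) σ := fun _ h => hasDerivAt_modeA h
/-- `A₁' = A₂` (quantified form). [folklore] -/
theorem modeA₁_deriv : ∀ σ : ℝ, -1 < σ → HasDerivAt modeA₁ (modeA₂ σ) σ := fun _ h => hasDerivAt_modeA₁ h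
/-- `B' = B₁` (quantified form). [folklore] -/
theorem modeB_deriv : ∀ σ : ℝ, -1 < σ → HasDerivAt modeB (modeB₁ σ) σ := fun _ h => hasDerivAt_modeB h
/-- `B₁' = B₂` (quantified form). [folklore] -/
theorem modeB₁_deriv : ∀ σ : ℝ, -1 < σ → HasDerivAt modeB₁ (modeB₂ σ) σ := fun _ h => hasDerivAt_modeB₁ h
/-- `ϖ' = ϖ₁` (quantified form). [folklore] -/
theorem modeP_deriv : ∀ σ : ℝ, -1 < σ → HasDerivAt modeP (modeP₁ σ) σ := fun _ h => hasDerivAt_modeP h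

/-- The derivative of `W` (as a continuous linear map). -/
theorem hasFDerivAt_neutralW (y : ℝ³) :
    HasFDerivAt (neutralW m)
      (((2 * modeA₁ (‖y‖ ^ 2)) • (innerSL ℝ y : ℝ³ →L[ℝ] ℝ)).smulRight m +
        ((modeB (‖y‖ ^ 2) * ⟪m, y⟫) • ContinuousLinearMap.id ℝ ℝ³ +
          (modeB (‖y‖ ^ 2) • (innerSL ℝ m : ℝ³ →L[ℝ] ℝ) +
            ⟪m, y⟫ • ((2 * modeB₁ (‖y‖ ^ 2)) • (innerSL ℝ y : ℝ³ →L[ℝ] ℝ))).smulRight y)) y := by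
  have h₁ : HasFDerivAt (fun w : ℝ³ => modeA (‖w‖ ^ 2) • m)
      (((2 * modeA₁ (‖y‖ ^ 2)) • (innerSL ℝ y : ℝ³ →L[ℝ] ℝ)).smulRight m) y :=
    (hasFDerivAt_radial modeA_deriv y).smul_const m
  have h₂ : HasFDerivAt (fun w : ℝ³ => (modeB (‖w‖ ^ 2) * ⟪m, w⟫) • w)
      ((modeB (‖y‖ ^ 2) * ⟪m, y⟫) • ContinuousLinearMap.id ℝ ℝ³ +
        (modeB (‖y‖ ^ 2) • (innerSL ℝ m : ℝ³ →L[ℝ] ℝ) +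
          ⟪m, y⟫ • ((2 * modeB₁ (‖y‖ ^ 2)) • (innerSL ℝ y : ℝ³ →L[ℝ] ℝ))).smulRight y) y :=
    (hasFDerivAt_radial_mul_inner m modeB_deriv y).fun_smul (hasFDerivAt_id y)
  exact h₁.add h₂

/-- `(y·∇)W = DW(y)y = 2σA' m + (B + B + 2σB')(m·y) y`. -/
theorem fderiv_neutralW_self (y : ℝ³) :
    fderiv ℝ (neutralW m) y y =
      (2 * modeA₁ (‖y‖ ^ 2) * ‖y‖ ^ 2) • m +
        ((modeB (‖y‖ ^ 2) + modeB (‖y‖ ^ 2) + 2 * modeB₁ (‖y‖ ^ 2) * ‖y‖ ^ 2) * ⟪m, y⟫) • y := by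
  rw [(hasFDerivAt_neutralW m y).fderiv]
  simp only [add_apply, smul_apply, ContinuousLinearMap.smulRight_apply, innerSL_apply_apply,
    ContinuousLinearMap.id_apply, real_inner_self_eq_norm_sq, smul_eq_mul]
  module

/-- `ΔW = (4σA'' + 6A') m + 2(B m + 2B'(m·y) y) + (4σB'' + 10B')(m·y) y`. -/
theorem laplacian_neutralW (y : ℝ³) :
    (Δ (neutralW m)) y =
      (4 * modeA₂ (‖y‖ ^ 2) * ‖y‖ ^ 2 + 6 * modeA₁ (‖y‖ ^ 2)) • m +
        ((2 : ℝ) • (modeB (‖y‖ ^ 2) • m + (2 * modeB₁ (‖y‖ ^ 2) * ⟪m, y⟫) • y) +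
          ((4 * modeB₂ (‖y‖ ^ 2) * ‖y‖ ^ 2 + 10 * modeB₁ (‖y‖ ^ 2)) * ⟪m, y⟫) • y) := by
  have hf₁ : ContDiff ℝ 2 (fun w : ℝ³ => modeA (‖w‖ ^ 2) • m) := contDiff_modeA_comp.smul contDiff_const
  have hf₂ : ContDiff ℝ 2 (fun w : ℝ³ => (modeB (‖w‖ ^ 2) * ⟪m, w⟫) • w) :=
    (contDiff_phi m).smul contDiff_id
  have hsplit : neutralW m = (fun w : ℝ³ => modeA (‖w‖ ^ 2) • m) +
      fun w : ℝ³ => (modeB (‖w‖ ^ 2) * ⟪m, w⟫) • w := rfl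
  rw [hsplit, (hf₁.contDiffAt (x := y)).laplacian_add (hf₂.contDiffAt (x := y))]
  -- first summand
  rw [laplacian_smul_const contDiff_modeA_comp m y, laplacian_radial modeA_deriv modeA₁_deriv y]
  -- second summand
  rw [laplacian_smul_field (e := fun w : ℝ³ => w) (contDiff_phi m) contDiff_id y,
    gradient_radial_mul_inner m modeB_deriv y,
    laplacian_radial_mul_inner m modeB_deriv modeB₁_deriv contDiff_modeB_comp y]
  have h0 : (Δ (fun w : ℝ³ => w)) y = 0 := laplacian_clm (ContinuousLinearMap.id ℝ ℝ³) y
  rw [h0, fderiv_fun_id]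
  simp only [smul_zero, zero_add, ContinuousLinearMap.id_apply]

/-- `∇Π = ϖ m + 2ϖ'(m·y) y`. -/
theorem gradient_neutralP (y : ℝ³) :
    gradient (neutralP m) y = modeP (‖y‖ ^ 2) • m + (2 * modeP₁ (‖y‖ ^ 2) * ⟪m, y⟫) • y :=
  gradient_radial_mul_inner m modeP_deriv y

/-- `M W = θ (y·W) y = θ (A + σB)(m·y) y`. -/
theorem neutralM_apply_neutralW (y : ℝ³) :
    neutralM y (neutralW m y) =
      (modeT (‖y‖ ^ 2) * ((modeA (‖y‖ ^ 2) + modeB (‖y‖ ^ 2) * ‖y‖ ^ 2) * ⟪m, y⟫)) • y := by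
  rw [neutralM_apply]
  unfold neutralW
  rw [inner_add_right, inner_smul_right, inner_smul_right, real_inner_self_eq_norm_sq,
    real_inner_comm y m]
  congr 1
  ring

/-- Additivity of the divergence at points of differentiability. -/
theorem divergence_add_of_differentiableAt {u v : ℝ³ → ℝ³} {x : ℝ³} (hu : DifferentiableAt ℝ u x)
    (hv : DifferentiableAt ℝ v x) :
    VectorCalculus.divergence (u + v) x = VectorCalculus.divergence u x + VectorCalculus.divergence v x := by
  unfold VectorCalculus.divergence
  rw [fderiv_add hu hv, ContinuousLinearMap.toLinearMap_add, map_add]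

/-- `div y = 3`. -/
theorem divergence_self (x : ℝ³) : VectorCalculus.divergence (fun w : ℝ³ => w) x = 3 := by
  unfold VectorCalculus.divergence
  rw [fderiv_fun_id, ContinuousLinearMap.coe_id, LinearMap.trace_id, finrank_euclideanSpace_fin]
  norm_num

/-- **`W` is divergence free.** -/
theorem divergence_neutralW (y : ℝ³) : VectorCalculus.divergence (neutralW m) y = 0 := by
  have hd₁ : DifferentiableAt ℝ (fun w : ℝ³ => modeA (‖w‖ ^ 2) • m) y :=
    ((hasFDerivAt_radial modeA_deriv y).smul_const m).differentiableAt
  have hφ : DifferentiableAt ℝ (fun w : ℝ³ => modeB (‖w‖ ^ 2) * ⟪m, w⟫) y :=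
    (hasFDerivAt_radial_mul_inner m modeB_deriv y).differentiableAt
  have hd₂ : DifferentiableAt ℝ (fun w : ℝ³ => (modeB (‖w‖ ^ 2) * ⟪m, w⟫) • w) y :=
    hφ.smul differentiableAt_id
  have hsplit : neutralW m = (fun w : ℝ³ => modeA (‖w‖ ^ 2) • m) +
      fun w : ℝ³ => (modeB (‖w‖ ^ 2) * ⟪m, w⟫) • w := rfl
  rw [hsplit, divergence_add_of_differentiableAt hd₁ hd₂,
    divergence_smul_const m (hasFDerivAt_radial modeA_deriv y).differentiableAt,
    (hasFDerivAt_radial modeA_deriv y).fderiv, divergence_smul_apply (u := fun w : ℝ³ => w) hφ differentiableAt_id,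
    divergence_self,
    gradient_radial_mul_inner m modeB_deriv y]
  simp only [smul_apply, innerSL_apply_apply, smul_eq_mul, inner_add_right, inner_smul_right,
    real_inner_self_eq_norm_sq]
  rw [real_inner_comm m y]
  have hσ := neg_one_lt_norm_sq y
  have h5 : brInv (‖y‖ ^ 2) ^ 5 = brInv (‖y‖ ^ 2) ^ 7 * (1 + ‖y‖ ^ 2) := brInv_pow_eq hσ 5
  unfold modeA₁ modeB modeB₁
  linear_combination (12 * ⟪m, y⟫) * h5

end Formulas


/-! ### §7.7 The identity `ΔW − ½(y·∇)W − ½W − MW − ∇Π = 0` -/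

section Identity

variable (m : ℝ³)

/-- **THE NEUTRAL-MODE IDENTITY** (exact, on all of `ℝ³`): the stationary linearised Leray equation with
potential `M` and pressure `Π` holds for `W`. -/
theorem neutral_identity (y : ℝ³) :
    (Δ (neutralW m)) y - (1 / 2 : ℝ) • fderiv ℝ (neutralW m) y y - (1 / 2 : ℝ) • neutralW m y -
        neutralM y (neutralW m y) - gradient (neutralP m) y = 0 := by
  rw [laplacian_neutralW, fderiv_neutralW_self, neutralM_apply_neutralW, gradient_neutralP]
  unfold neutralW
  have hσ := neg_one_lt_norm_sq y
  have h5 : brInv (‖y‖ ^ 2) ^ 5 = brInv (‖y‖ ^ 2) ^ 13 * (1 + ‖y‖ ^ 2) ^ 4 := by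
    rw [brInv_pow_eq hσ 5, brInv_pow_eq hσ 7, brInv_pow_eq hσ 9, brInv_pow_eq hσ 11]; ring
  have h7 : brInv (‖y‖ ^ 2) ^ 7 = brInv (‖y‖ ^ 2) ^ 13 * (1 + ‖y‖ ^ 2) ^ 3 := by
    rw [brInv_pow_eq hσ 7, brInv_pow_eq hσ 9, brInv_pow_eq hσ 11]; ring
  have h9 : brInv (‖y‖ ^ 2) ^ 9 = brInv (‖y‖ ^ 2) ^ 13 * (1 + ‖y‖ ^ 2) ^ 2 := by
    rw [brInv_pow_eq hσ 9, brInv_pow_eq hσ 11]; ring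
  have h11 : brInv (‖y‖ ^ 2) ^ 11 = brInv (‖y‖ ^ 2) ^ 13 * (1 + ‖y‖ ^ 2) := brInv_pow_eq hσ 11
  unfold modeA modeA₁ modeA₂ modeB modeB₁ modeB₂ modeP modeP₁ modeT
  match_scalars
  · linear_combination ((‖y‖ ^ 2) ^ 3 - 39 / 2 * (‖y‖ ^ 2) ^ 2 + 21 / 2 * ‖y‖ ^ 2 + 31) * h9 +
      (-(3 / 2) * (‖y‖ ^ 2) ^ 2 + 15 * ‖y‖ ^ 2 - 36) * h7 + (5 + ‖y‖ ^ 2 / 2) * h5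
  · linear_combination (105 * ‖y‖ ^ 2 * ⟪m, y⟫) * h9 + ((15 / 2 * ‖y‖ ^ 2 - 105) * ⟪m, y⟫) * h7 +
      (-(9 / 2) * ⟪m, y⟫) * h5 +
      (-(3 * (‖y‖ ^ 2) ^ 3 - 57 / 2 * (‖y‖ ^ 2) ^ 2 - 1077 / 2 * ‖y‖ ^ 2 + 438) * ⟪m, y⟫) * h11

end Identity


/-! ### §7.8 Size: cubic decay of `W`, critical bound `|M| ≤ 30/(1+|y|²)`, non-triviality -/

section Bounds

variable (m : ℝ³)

/-- `|W(y)|² ≤ 4 ζ⁶ = 4/(1+|y|²)³` when `|m| = 1` (equality on the axis `y ∥ m`). -/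
theorem norm_neutralW_sq_le (hm : ‖m‖ = 1) (y : ℝ³) :
    ‖neutralW m y‖ ^ 2 ≤ 4 / (1 + ‖y‖ ^ 2) ^ 3 := by
  have hσ := neg_one_lt_norm_sq y
  set z := brInv (‖y‖ ^ 2) with hz
  have hz0 : 0 ≤ z := (brInv_pos hσ).le
  have hrel : z ^ 2 * (1 + ‖y‖ ^ 2) = 1 := brInv_sq_mul hσ
  have hpos : 0 < 1 + ‖y‖ ^ 2 := one_add_pos hσ
  -- expand the square
  have hexp : ‖neutralW m y‖ ^ 2 =
      modeA (‖y‖ ^ 2) ^ 2 + 2 * (modeA (‖y‖ ^ 2) * (modeB (‖y‖ ^ 2) * ⟪m, y⟫) * ⟪m, y⟫) +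
        (modeB (‖y‖ ^ 2) * ⟪m, y⟫) ^ 2 * ‖y‖ ^ 2 := by
    unfold neutralW
    rw [norm_add_sq_real, norm_smul, norm_smul, inner_smul_left, inner_smul_right, mul_pow, mul_pow,
      hm, Real.norm_eq_abs, Real.norm_eq_abs, sq_abs, sq_abs]
    simp only [RCLike.conj_to_real]
    ring
  have hcs : ⟪m, y⟫ ^ 2 ≤ ‖y‖ ^ 2 := by
    have h1 : |⟪m, y⟫| ≤ ‖m‖ * ‖y‖ := abs_real_inner_le_norm m y
    rw [hm, one_mul] at h1
    nlinarith [abs_nonneg ⟪m, y⟫, sq_abs ⟪m, y⟫]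
  have hkey : modeA (‖y‖ ^ 2) ^ 2 + 2 * (modeA (‖y‖ ^ 2) * (modeB (‖y‖ ^ 2) * ⟪m, y⟫) * ⟪m, y⟫) +
      (modeB (‖y‖ ^ 2) * ⟪m, y⟫) ^ 2 * ‖y‖ ^ 2 =
        z ^ 10 * ((2 - ‖y‖ ^ 2) ^ 2 + ⟪m, y⟫ ^ 2 * (12 + 3 * ‖y‖ ^ 2)) := by
    unfold modeA modeB; ring
  have hmono : z ^ 10 * ((2 - ‖y‖ ^ 2) ^ 2 + ⟪m, y⟫ ^ 2 * (12 + 3 * ‖y‖ ^ 2)) ≤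
      z ^ 10 * ((2 - ‖y‖ ^ 2) ^ 2 + ‖y‖ ^ 2 * (12 + 3 * ‖y‖ ^ 2)) := by
    refine mul_le_mul_of_nonneg_left ?_ (pow_nonneg hz0 10)
    have h12 : 0 ≤ 12 + 3 * ‖y‖ ^ 2 := by positivity
    nlinarith [mul_le_mul_of_nonneg_right hcs h12]
  have hval : z ^ 10 * ((2 - ‖y‖ ^ 2) ^ 2 + ‖y‖ ^ 2 * (12 + 3 * ‖y‖ ^ 2)) = 4 * z ^ 6 := by
    have h6 : z ^ 6 = z ^ 10 * (1 + ‖y‖ ^ 2) ^ 2 := by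
      rw [hz, brInv_pow_eq hσ 6, brInv_pow_eq hσ 8]; ring
    rw [h6]; ring
  have hz6 : z ^ 6 = 1 / (1 + ‖y‖ ^ 2) ^ 3 := by
    have hz2 : z ^ 2 = 1 / (1 + ‖y‖ ^ 2) := by
      field_simp; linarith [hrel]
    calc z ^ 6 = (z ^ 2) ^ 3 := by ring
      _ = 1 / (1 + ‖y‖ ^ 2) ^ 3 := by rw [hz2, div_pow, one_pow]
  calc ‖neutralW m y‖ ^ 2 = z ^ 10 * ((2 - ‖y‖ ^ 2) ^ 2 + ⟪m, y⟫ ^ 2 * (12 + 3 * ‖y‖ ^ 2)) := by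
        rw [hexp, hkey]
    _ ≤ 4 * z ^ 6 := hmono.trans_eq hval
    _ = 4 / (1 + ‖y‖ ^ 2) ^ 3 := by rw [hz6]; ring

/-- The two polynomial inequalities behind `sup (1+σ)|M| = sup (15/4)σ|4σ²+57σ−73|/(1+σ)³ ≈ 28.4 ≤ 30`. -/
theorem poly_bound {σ : ℝ} (hσ : 0 ≤ σ) : |σ * (4 * σ ^ 2 + 57 * σ - 73)| ≤ 8 * (1 + σ) ^ 3 := by
  rw [abs_le]
  constructor
  · nlinarith [sq_nonneg (σ - 49 / 162), mul_nonneg hσ (sq_nonneg σ)]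
  · nlinarith [mul_nonneg hσ (sq_nonneg (σ - 33 / 8))]

/-- **CRITICAL SIZE OF THE POTENTIAL**: `‖M(y)‖ ≤ 30/(1+|y|²)` (operator norm; `~ 15/|y|²` at infinity). -/
theorem norm_neutralM_le (y : ℝ³) : ‖neutralM y‖ ≤ 30 / (1 + ‖y‖ ^ 2) := by
  have hσ := neg_one_lt_norm_sq y
  have hpos : 0 < 1 + ‖y‖ ^ 2 := one_add_pos hσ
  set z := brInv (‖y‖ ^ 2) with hz
  have hz0 : 0 ≤ z := (brInv_pos hσ).le
  have hrel : z ^ 2 * (1 + ‖y‖ ^ 2) = 1 := brInv_sq_mul hσ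
  -- operator norm ≤ |θ| |y|²
  have hop : ‖neutralM y‖ ≤ |modeT (‖y‖ ^ 2)| * ‖y‖ ^ 2 := by
    refine ContinuousLinearMap.opNorm_le_bound _ (by positivity) fun v => ?_
    rw [neutralM_apply, norm_smul, Real.norm_eq_abs, abs_mul]
    have h1 : |⟪y, v⟫| ≤ ‖y‖ * ‖v‖ := abs_real_inner_le_norm y v
    have h2 : 0 ≤ |modeT (‖y‖ ^ 2)| := abs_nonneg _
    calc |modeT (‖y‖ ^ 2)| * |⟪y, v⟫| * ‖y‖ ≤ |modeT (‖y‖ ^ 2)| * (‖y‖ * ‖v‖) * ‖y‖ := by gcongr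
      _ = |modeT (‖y‖ ^ 2)| * ‖y‖ ^ 2 * ‖v‖ := by ring
  -- |θ| σ = (15/4) |σ(4σ²+57σ−73)| z⁸ ≤ 30 z²
  have hz8 : z ^ 8 = (z ^ 2) ^ 4 := by ring
  have hz2 : z ^ 2 = 1 / (1 + ‖y‖ ^ 2) := by field_simp; linarith [hrel]
  have hval : |modeT (‖y‖ ^ 2)| * ‖y‖ ^ 2 =
      15 / 4 * |‖y‖ ^ 2 * (4 * (‖y‖ ^ 2) ^ 2 + 57 * ‖y‖ ^ 2 - 73)| * z ^ 8 := by
    unfold modeT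
    rw [abs_mul, abs_mul, abs_of_nonneg (by norm_num : (0 : ℝ) ≤ 15 / 4), abs_of_nonneg (pow_nonneg hz0 8),
      abs_mul, abs_of_nonneg (sq_nonneg ‖y‖)]
    ring
  have hpoly := poly_bound (sq_nonneg ‖y‖)
  calc ‖neutralM y‖ ≤ |modeT (‖y‖ ^ 2)| * ‖y‖ ^ 2 := hop
    _ = 15 / 4 * |‖y‖ ^ 2 * (4 * (‖y‖ ^ 2) ^ 2 + 57 * ‖y‖ ^ 2 - 73)| * z ^ 8 := hval
    _ ≤ 15 / 4 * (8 * (1 + ‖y‖ ^ 2) ^ 3) * z ^ 8 := by gcongr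
    _ = 30 / (1 + ‖y‖ ^ 2) := by
        rw [hz8, hz2]
        field_simp
        ring

/-- `W(0) = 2m`: the mode is non-trivial (indeed `|W| = 2⟨y⟩⁻³` on the axis). -/
theorem neutralW_zero : neutralW m 0 = (2 : ℝ) • m := by
  unfold neutralW modeA
  simp [brInv_zero]

end Bounds

/-! ### §7.9 The refuted rigidity statements -/

/-- **ZERO-SCAR NEUTRAL-MODE RIGIDITY at potential size `C₂`** (similarity variables `y = x/√(−t)`):
every `C²` divergence-free STATIONARY solution `W` of the linearised Leray (Stokes–Ornstein–Uhlenbeck)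
system `ΔW − ½(y·∇)W − ½W − M W − ∇Π = 0` on `ℝ³`, with a matrix potential of the Type-I-critical size
`‖M(y)‖ ≤ C₂/(1+|y|²)` and the ZERO-SCAR decay `|W(y)|² ≤ K/(1+|y|²)³` (i.e. `w = O((−t)|x|⁻³)` in physical
variables), vanishes.  This is the coefficient/inequality form of the crux's linearised statement
("an s-bounded `O(|y|⁻³)` solution of the linearised difference system vanishes") with the drift dropped
and `W·∇Ū` (`|∇Ū| ≲ C⟨y⟩⁻²`) replaced by a general potential of the same size. -/
def NeutralModeRigidity (C₂ : ℝ) : Prop :=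
  ∀ (W : ℝ³ → ℝ³) (P : ℝ³ → ℝ) (M : ℝ³ → ℝ³ →L[ℝ] ℝ³),
    ContDiff ℝ 2 W → Differentiable ℝ P →
    (∀ y, ‖M y‖ ≤ C₂ / (1 + ‖y‖ ^ 2)) →
    (∀ y, VectorCalculus.divergence W y = 0) →
    (∃ K : ℝ, ∀ y, ‖W y‖ ^ 2 ≤ K / (1 + ‖y‖ ^ 2) ^ 3) →
    (∀ y, (Δ W) y - (1 / 2 : ℝ) • fderiv ℝ W y y - (1 / 2 : ℝ) • W y - M y (W y) - gradient P y = 0) →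
    ∀ y, W y = 0

/-- The unit vector `e₀`. -/
def e0 : ℝ³ := EuclideanSpace.single 0 1

/-- `|e₀| = 1`. [folklore] -/
theorem norm_e0 : ‖e0‖ = 1 := by simp [e0]

/-- `e₀ ≠ 0`. [folklore] -/
theorem e0_ne_zero : e0 ≠ 0 := by
  intro h; have := norm_e0; rw [h, norm_zero] at this; exact zero_ne_one this

/-- **NEUTRAL-MODE RIGIDITY IS FALSE at `C₂ = 30`**: the explicit mode `(W, Π, M)` of §7.3. -/
theorem neutralModeRigidity_false : ¬ NeutralModeRigidity 30 := by
  intro h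
  have h0 := h (neutralW e0) (neutralP e0) neutralM (contDiff_neutralW e0)
    ((contDiff_neutralP e0 (n := 1)).differentiable one_ne_zero) norm_neutralM_le (divergence_neutralW e0)
    ⟨4, norm_neutralW_sq_le e0 norm_e0⟩ (neutral_identity e0) 0
  rw [neutralW_zero] at h0
  exact e0_ne_zero (by simpa using h0)

/-- **THE ETERNAL (s-dependent) FORM, verbatim the shape of the crux's linearised statement**: every
two-sided (`s ∈ ℝ`) solution of `∂ₛW = ΔW − ½(y·∇)W − ½W − M W − ∇Π`, `div W = 0`, with potential size
`C₂` and the s-UNIFORM zero-scar bound `|W(s,y)|² ≤ K/(1+|y|²)³`, vanishes. -/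
def LinearisedScarRigidity (C₂ : ℝ) : Prop :=
  ∀ (W : ℝ → ℝ³ → ℝ³) (P : ℝ → ℝ³ → ℝ) (M : ℝ → ℝ³ → ℝ³ →L[ℝ] ℝ³),
    (∀ s, ContDiff ℝ 2 (W s)) → (∀ s, Differentiable ℝ (P s)) →
    (∀ s y, ‖M s y‖ ≤ C₂ / (1 + ‖y‖ ^ 2)) →
    (∀ s y, VectorCalculus.divergence (W s) y = 0) →
    (∃ K : ℝ, ∀ s y, ‖W s y‖ ^ 2 ≤ K / (1 + ‖y‖ ^ 2) ^ 3) →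
    (∀ s y, timeDeriv W s y =
      (Δ (W s)) y - (1 / 2 : ℝ) • fderiv ℝ (W s) y y - (1 / 2 : ℝ) • W s y - M s y (W s y) - gradient (P s) y) →
    ∀ s y, W s y = 0

/-- **LINEARISED SCAR RIGIDITY IS FALSE at `C₂ = 30`** (the stationary mode is an eternal solution). -/
theorem linearisedScarRigidity_false : ¬ LinearisedScarRigidity 30 := by
  intro h
  have h0 := h (fun _ => neutralW e0) (fun _ => neutralP e0) (fun _ => neutralM)
    (fun _ => contDiff_neutralW e0) (fun _ => (contDiff_neutralP e0 (n := 1)).differentiable one_ne_zero)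
    (fun _ => norm_neutralM_le) (fun _ => divergence_neutralW e0) ⟨4, fun _ => norm_neutralW_sq_le e0 norm_e0⟩
    (fun s y => by rw [timeDeriv_apply, deriv_const, neutral_identity e0 y]) 0 0
  rw [neutralW_zero] at h0
  exact e0_ne_zero (by simpa using h0)


/-! ### §7.10 Physical variables: `w = (−t)^{-1/2} W(x/√(−t))` on the backward slab -/

section Physical

variable (m : ℝ³)

/-- The Leray scale `λ(t) = 1/√(−t)` in the tree's normal form (`a = ½`, `T = 0`). -/
def sc (t : ℝ) : ℝ := (Real.sqrt (2 * (1 / 2 : ℝ) * (0 - t)))⁻¹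

/-- `λ(t)² = (−t)⁻¹`. [folklore] -/
theorem sc_sq {t : ℝ} (ht : t < 0) : sc t ^ 2 = (-t)⁻¹ := by
  rw [sc, lerayScale_sq (by norm_num : (0 : ℝ) < 1 / 2) ht]; norm_num

/-- `λ(t) > 0` for `t < 0`. [folklore] -/
theorem sc_pos {t : ℝ} (ht : t < 0) : 0 < sc t := lerayScale_pos (by norm_num : (0 : ℝ) < 1 / 2) ht

/-- `λ(−1) = 1`. [folklore] -/
theorem sc_neg_one : sc (-1) = 1 := by
  rw [sc, show (2 * (1 / 2 : ℝ) * (0 - (-1))) = 1 by norm_num, Real.sqrt_one, inv_one]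

/-- THE PHYSICAL MODE `w(t,x) = λ W(λx)`, `λ = 1/√(−t)` (Leray's backward ansatz of the tree). -/
def physW : ℝ → ℝ³ → ℝ³ := lerayBackward (1 / 2) 0 (neutralW m)

/-- Its pressure `π(t,x) = λ² Π(λx) = (−t)⁻¹ Π(x/√(−t))`. -/
def physP (t : ℝ) (x : ℝ³) : ℝ := sc t ^ 2 * neutralP m (sc t • x)

/-- Its potential `𝓜(t,x) = λ² M(λx) = (−t)⁻¹ M(x/√(−t))`. -/
def physM (t : ℝ) (x : ℝ³) : ℝ³ →L[ℝ] ℝ³ := sc t ^ 2 • neutralM (sc t • x)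

/-- Unfolding `w(t,x) = λ W(λx)`. [folklore] -/
theorem physW_apply (t : ℝ) (x : ℝ³) : physW m t x = sc t • neutralW m (sc t • x) := rfl

/-- **THE PDE in physical variables**: `∂ₜw − Δw + 𝓜 w + ∇π = 0` pointwise on `ℝ³ × (−∞,0)`. -/
theorem physW_momentum {t : ℝ} (ht : t < 0) (x : ℝ³) :
    timeDeriv (physW m) t x - (Δ (physW m t)) x + physM t x (physW m t x) + gradient (physP m t) x = 0 := by
  have ha : (0 : ℝ) < 1 / 2 := by norm_num
  have hT := timeDeriv_lerayBackward ha ht (contDiff_neutralW m (n := 1)) x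
  have hL := laplacian_lerayBackward (contDiff_neutralW m (n := 2)) (1 / 2) 0 t x
  have hG : gradient (physP m t) x = sc t ^ 3 • gradient (neutralP m) (sc t • x) := by
    have h : physP m t = fun y => sc t ^ 2 * (neutralP m (sc t • y) - 0) := by
      funext y; simp [physP]
    rw [h, gradient_sq_mul_comp_smul_sub]
  have hM : physM t x (physW m t x) = sc t ^ 3 • neutralM (sc t • x) (neutralW m (sc t • x)) := by
    rw [physW_apply, physM, smul_apply, map_smul, smul_smul, show sc t ^ 2 * sc t = sc t ^ 3 by ring]
  rw [hM, hG]
  unfold physW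
  rw [hT, hL]
  have key := neutral_identity m (sc t • x)
  have e : ((1 / 2 : ℝ) * (Real.sqrt (2 * (1 / 2 : ℝ) * (0 - t)))⁻¹ ^ 3) •
        (neutralW m ((Real.sqrt (2 * (1 / 2 : ℝ) * (0 - t)))⁻¹ • x) +
          fderiv ℝ (neutralW m) ((Real.sqrt (2 * (1 / 2 : ℝ) * (0 - t)))⁻¹ • x)
            ((Real.sqrt (2 * (1 / 2 : ℝ) * (0 - t)))⁻¹ • x)) -
        (Real.sqrt (2 * (1 / 2 : ℝ) * (0 - t)))⁻¹ ^ 3 •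
          (Δ (neutralW m)) ((Real.sqrt (2 * (1 / 2 : ℝ) * (0 - t)))⁻¹ • x) +
        sc t ^ 3 • neutralM (sc t • x) (neutralW m (sc t • x)) +
        sc t ^ 3 • gradient (neutralP m) (sc t • x) =
      -(sc t ^ 3) • ((Δ (neutralW m)) (sc t • x) - (1 / 2 : ℝ) • fderiv ℝ (neutralW m) (sc t • x) (sc t • x) -
        (1 / 2 : ℝ) • neutralW m (sc t • x) - neutralM (sc t • x) (neutralW m (sc t • x)) -
        gradient (neutralP m) (sc t • x)) := by
    simp only [sc]
    module
  rw [e, key, smul_zero]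

/-- `div w(t) = 0`. -/
theorem physW_divFree (t : ℝ) (x : ℝ³) : VectorCalculus.divergence (physW m t) x = 0 := by
  rw [physW, divergence_lerayBackward, divergence_neutralW, mul_zero]

/-- **APEX TYPE-I + CUBIC FLATNESS IN ONE BOUND**: `|w(t,x)|² ≤ 4(−t)²/((−t)+|x|²)³`, i.e.
`|w| ≤ 2/√((−t)+|x|²) ≤ 2√2/(|x|+√(−t))` (apex bound) and `|w| ≤ 2(−t)/|x|³` (zero scar). -/
theorem physW_sq_le (hm : ‖m‖ = 1) {t : ℝ} (ht : t < 0) (x : ℝ³) :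
    ‖physW m t x‖ ^ 2 ≤ 4 * (-t) ^ 2 / (-t + ‖x‖ ^ 2) ^ 3 := by
  have hs2 := sc_sq ht
  obtain ⟨τ, hτ, rfl⟩ : ∃ τ : ℝ, 0 < τ ∧ t = -τ := ⟨-t, by linarith, by ring⟩
  rw [neg_neg] at hs2 ⊢
  rw [physW_apply, norm_smul, mul_pow, Real.norm_eq_abs, sq_abs, hs2]
  have hW := norm_neutralW_sq_le m hm (sc (-τ) • x)
  rw [norm_smul, mul_pow, Real.norm_eq_abs, sq_abs, hs2] at hW
  have hx : 0 ≤ ‖x‖ ^ 2 := sq_nonneg _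
  have e1 : 1 + τ⁻¹ * ‖x‖ ^ 2 = (τ + ‖x‖ ^ 2) / τ := by field_simp
  rw [e1, div_pow, div_div_eq_mul_div] at hW
  calc τ⁻¹ * ‖neutralW m (sc (-τ) • x)‖ ^ 2 ≤ τ⁻¹ * (4 * τ ^ 3 / (τ + ‖x‖ ^ 2) ^ 3) := by gcongr
    _ = 4 * τ ^ 2 / (τ + ‖x‖ ^ 2) ^ 3 := by field_simp

/-- **CRITICAL SIZE OF THE POTENTIAL in physical variables**: `‖𝓜(t,x)‖ ≤ 30/((−t)+|x|²)`
(`≤ 60/(|x|+√(−t))²`). -/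
theorem physM_le {t : ℝ} (ht : t < 0) (x : ℝ³) : ‖physM t x‖ ≤ 30 / (-t + ‖x‖ ^ 2) := by
  have hs2 := sc_sq ht
  obtain ⟨τ, hτ, rfl⟩ : ∃ τ : ℝ, 0 < τ ∧ t = -τ := ⟨-t, by linarith, by ring⟩
  rw [neg_neg] at hs2 ⊢
  rw [physM, norm_smul, Real.norm_eq_abs, abs_of_nonneg (sq_nonneg _), hs2]
  have hM := norm_neutralM_le (sc (-τ) • x)
  rw [norm_smul, mul_pow, Real.norm_eq_abs, sq_abs, hs2] at hM
  have hx : 0 ≤ ‖x‖ ^ 2 := sq_nonneg _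
  have e1 : 1 + τ⁻¹ * ‖x‖ ^ 2 = (τ + ‖x‖ ^ 2) / τ := by field_simp
  rw [e1, div_div_eq_mul_div] at hM
  calc τ⁻¹ * ‖neutralM (sc (-τ) • x)‖ ≤ τ⁻¹ * (30 * τ / (τ + ‖x‖ ^ 2)) := by gcongr
    _ = 30 / (τ + ‖x‖ ^ 2) := by field_simp

/-- Non-triviality: `w(−1, 0) = 2m` (the mode is singular at the apex: `w(t,0) = 2m/√(−t)`). -/
theorem physW_neg_one_zero : physW m (-1) 0 = (2 : ℝ) • m := by
  rw [physW_apply, sc_neg_one, smul_zero, neutralW_zero, one_smul]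

/-- Smoothness of the slices. -/
theorem contDiff_physW (t : ℝ) {n : ℕ∞} : ContDiff ℝ n (physW m t) := by
  have h : physW m t = fun x => sc t • neutralW m (sc t • x) := rfl
  rw [h]
  exact ((contDiff_neutralW m).comp (contDiff_const_smul _)).const_smul _

/-- The pressure slices are smooth. [folklore] -/
theorem contDiff_physP (t : ℝ) {n : ℕ∞} : ContDiff ℝ n (physP m t) := by
  have h : physP m t = fun x => sc t ^ 2 * neutralP m (sc t • x) := rfl
  rw [h]
  exact contDiff_const.mul ((contDiff_neutralP m).comp (contDiff_const_smul _))

/-- The pressure slices are differentiable. [folklore] -/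
theorem differentiable_physP (t : ℝ) : Differentiable ℝ (physP m t) :=
  (contDiff_physP m t (n := 1)).differentiable one_ne_zero

/-- **DIFFERENCE-INEQUALITY RIGIDITY at coefficient size `C₂`** (physical variables, the whole open
backward slab).  The difference `w = u₁ − u₂` of two scar-sharing apex profiles solves
`∂ₜw − Δw + ū·∇w + w·∇ū + ∇π = 0`, `div w = 0`, with `|ū| ≤ C/(|x|+√−t)` and (by local regularity)
`|∇ū| ≲ C/(|x|+√−t)²`; a SIZE-BASED proof retains of `w·∇ū` only a potential `V` with
`‖V(t,x)‖ ≤ C₂/((−t)+|x|²)` (`≤ 2C₂/(|x|+√−t)²`).  The statement: every slice-wise `C²`, divergence-free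
`w` on `ℝ³×(−∞,0)` solving `∂ₜw − Δw + V w + ∇p = 0` with such a `V`, and obeying the single bound
`|w(t,x)|² ≤ K(−t)²/((−t)+|x|²)³` — which packs the APEX TYPE-I bound `|w| ≤ √(2K)/(|x|+√−t)`, the
ZERO SCAR with cubic flatness `|w| ≤ √K(−t)/|x|³` (so `ess sup_{(−δ,0)×K}|w| → 0`) and the finite-energy
ticket `‖w(t)‖₂ ≲ (−t)^{1/4}` — vanishes identically. -/
def DifferenceInequalityRigidity (C₂ : ℝ) : Prop :=
  ∀ (w : ℝ → ℝ³ → ℝ³) (p : ℝ → ℝ³ → ℝ) (V : ℝ → ℝ³ → ℝ³ →L[ℝ] ℝ³),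
    (∀ t < 0, ContDiff ℝ 2 (w t)) → (∀ t < 0, Differentiable ℝ (p t)) →
    (∀ t < 0, ∀ x, ‖V t x‖ ≤ C₂ / (-t + ‖x‖ ^ 2)) →
    (∀ t < 0, ∀ x, VectorCalculus.divergence (w t) x = 0) →
    (∃ K : ℝ, ∀ t < 0, ∀ x, ‖w t x‖ ^ 2 ≤ K * (-t) ^ 2 / (-t + ‖x‖ ^ 2) ^ 3) →
    (∀ t < 0, ∀ x, timeDeriv w t x - (Δ (w t)) x + V t x (w t x) + gradient (p t) x = 0) →
    ∀ t < 0, ∀ x, w t x = 0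

/-- **DIFFERENCE-INEQUALITY RIGIDITY IS FALSE at `C₂ = 30`**: the self-similar mode
`w = (−t)^{-1/2} W(x/√(−t))` with its pressure and potential (an ETERNAL solution on the whole slab,
singular at the apex like a Type-I profile: `w(t,0) = 2e₀/√(−t)`). -/
theorem differenceInequalityRigidity_false : ¬ DifferenceInequalityRigidity 30 := by
  intro h
  have h0 := h (physW e0) (physP e0) physM (fun t _ => contDiff_physW e0 t) (fun t _ => differentiable_physP e0 t)
    (fun t ht x => physM_le ht x) (fun t _ x => physW_divFree e0 t x)
    ⟨4, fun t ht x => by simpa using physW_sq_le e0 norm_e0 ht x⟩ (fun t ht x => physW_momentum e0 ht x)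
    (-1) (by norm_num) 0
  rw [physW_neg_one_zero] at h0
  exact e0_ne_zero (by simpa using h0)

end Physical


/-! ### §7.11 (paper) Exact structure: the dipole-tailed mode is NOT a neutral mode of the true linearised
operator around any divergence-free background — momentum conservation; the quadrupole question -/

/-- **EXACT-STRUCTURE OBSTRUCTION FOR THE §7 MODE (paper; Lean target for a later cycle).**  Let `W, Π₀, ρ`
be as in §7 (`LW = ∇Π₀ + ρ(|y|²)m`, `L = Δ − ½y·∇ − ½`).  There is NO pair `(Ū, Πₜ)` with `Ū ∈ C¹`
divergence free, `Ū = O(1)`, `∇Ū = O(|y|^{-1-ε})` (in particular no Type-I-size background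
`|Ū| ≲ C⟨y⟩⁻¹, |∇Ū| ≲ C⟨y⟩⁻²`) such that `LW = (Ū·∇)W + (W·∇)Ū + ∇Πₜ` on `ℝ³`, i.e. `W` is not a zero-scar
neutral mode of the EXACT linearised Leray operator around any such background.
PROOF (integrate the `m`-component over `B_R`, `R → ∞`).  LHS: `∫_{B_R} LW = ∮_{S_R} Π₀ n + (∫_{B_R} ρ) m`;
`Π₀ = ∂ₘq − ½y·∇h = −(m·ŷ)|y|⁻² + O(|y|⁻⁴)` gives `∮Π₀ n → −(4π/3)m`, and
`∫_{ℝ³} ρ = ½∫(y·∇q + q) − ∫Δq = −∫ q = −∫ ΔG = 4π` (the total charge of the Plummer potential: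
`−ΔG = 3⟨y⟩⁻⁵`, `∫ 3⟨y⟩⁻⁵ dy = 4π`); so LHS `→ (8π/3)m`.  RHS: both fields are divergence free, so
`(Ū·∇)W + (W·∇)Ū = ∇·(Ū⊗W + W⊗Ū)` and `∫_{B_R} = ∮_{S_R}[(Ū·n)W + (W·n)Ū] = O(R²·R⁻³) → 0`
(`|W| ≤ 2|y|⁻³`); the pressure is forced by the equation: `∇(Πₜ − Π₀) = ρm − ∇·(Ū⊗W+W⊗Ū) = O(|y|⁻⁴)`
(`ρ ~ 6|y|⁻⁵`), hence `Πₜ − Π₀ = c + O(|y|⁻³)` and `∮_{S_R} Πₜ n → ∮ Π₀ n = −(4π/3)m`.  Equating,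
`4π m = 0` — contradiction.  ∎
MEANING.  The obstruction is the translation Killing field in the cokernel of `Ū ↦ P[(Ū·∇)W + (W·∇)Ū]`,
i.e. MOMENTUM CONSERVATION of the pair — exactly the `ℓ = 1` law of card moment-conditioned-rellich (ii)/(A):
for a true Navier–Stokes pair the dipole (`(−t)|x|⁻³`) painted tail vanishes, and the §7 mode lives on that
tail (its far field IS the dipole potential flow, moment `∝ ∫(−ΔG) = 4π`).  So the §7 barrier hits methods
blind to the divergence/Jacobian structure of `w·∇ū` (pure size / inequality methods), while a method that
uses that structure recovers at least the first rung of the painted ladder — consistent with, and a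
certificate for, MCR's design.  THE NEXT QUESTION (open; numerics j008767 = dipole calibration, j008913 =
dipole vs quadrupole least squares): an exact-structure zero-scar neutral mode with QUADRUPOLE far field,
e.g. `W₂ = ∇(∂_z²G) − (∂_zΔG)e_z` (smooth, divergence free, `W₂ ~ ∇∂_z²(1/|y|) = O(|y|⁻⁴)`, flatness
`(−t)^{3/2}|x|⁻⁴` — precisely the flatness stub_paintedLadder predicts for true pairs): here BOTH Killing
obstructions vanish identically (`∫LW₂ = 0` by parity, `∫ y×LW₂ = 0` by axisymmetry), so solvability of
`(Ū·∇)W₂ + (W₂·∇)Ū + ∇Πₜ = LW₂` is decided by the decaying part of the cokernel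
`{V : [W₂,V] − V×curl W₂ = ∇q}` of a non-elliptic (transport-type, closed streamlines) operator.  A solvable
quadrupole case would extend the barrier to ALL linear methods (only the profile equation of `ū` itself
could then prove the crux); an obstruction would be a genuinely new conservation-type identity at `ℓ = 2` —
the very identity MCR's closing rung `stub_quadrupoleDefectVanishes` is missing. -/
theorem exactStructure_dipole_obstruction_note : True := trivial



/-! ## §8 (cycle 4, NEW) The small-constant slices are VACUOUS up to `C ≈ 1.16`:
Liouville by Oseen-kernel contraction in the apex normalisation

**Theorem (paper + numerics; evidence `liouville-vacuity.md`, kit job j010409).**  Let `Φ(t,x) = 1/(|x|+√(−t))`.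
Every ancient Oseen-mild field `u` on `ℝ³ × (−∞,0)` (Duhamel formula between all pairs of times, the class
`IsTypeIAncientMild` of stub S1α) with `|u(t,x)| ≤ C Φ(t,x)` and `C < C_L := 1/κ♯`, `κ♯ = 0.8594…`, i.e.
`C < 1.163`, is identically zero.

*Proof.*  `A := sup |u|/Φ ≤ C`.  Since `‖u(t₀)‖_∞ ≤ C/√(−t₀) → 0` as `t₀ → −∞` and the Duhamel integral converges
absolutely, `u = −B(u,u)`, `B(u,u)ᵢ(t,x) = ∫_{−∞}^t∫ ∂ₖ𝒪ᵢⱼ(t−τ, x−z) uⱼuₖ dz dτ` with the Oseen tensor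
`𝒪ᵢⱼ(s,ξ) = Γ(s,ξ)δᵢⱼ + ∂ᵢ∂ⱼ[erf(|ξ|/2√s)/(4π|ξ|)]` (Solonnikov).  For a unit vector `n`,
`n·B = ∫∫ uᵀQ⁽ⁿ⁾u` with `Q⁽ⁿ⁾ⱼₖ = Σᵢ nᵢ ∂ₖ𝒪ᵢⱼ`, hence `−n·u(t,x) ≤ A² ∫∫ λ_max⁺(sym Q⁽ⁿ⁾) Φ² ≤ κ♯ A² Φ(t,x)`
where, by scaling (`t = −1`, `η = (x−z)/√s`),
`κ♯ = sup_x sup_{n∈S²} (|x|+1) ∫₀^∞ s^{−1/2} ∫_{ℝ³} λ_max⁺(sym Q⁽ⁿ⁾(1,η)) (|x − √s η| + √(1+s))⁻² dη ds`.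
Explicitly (`ξ = η/|η|`, `c = n·ξ`, `r = |η|`, `Γ(r) = (4π)^{−3/2}e^{−r²/4}`, `h(r) = erf(r/2)/(4πr)`,
`α = h‴ − 3h″/r + 3h′/r²`, `β = h″/r − h′/r²`, `g = Γ′/2 + β`):
`sym Q⁽ⁿ⁾ = g(nξᵀ + ξnᵀ) + αc ξξᵀ + βc I`, `λ_max = max(c(g+α/2+β) + √(c²(g+α/2)² + g²(1−c²)), βc)`.
Taking `sup` over `n` gives `|u| ≤ κ♯A²Φ`, so `A ≤ κ♯A²` and `A = 0` once `κ♯C < 1` (`bootstrap_eq_zero`). ∎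

*Numbers* (two independent pure-python codes on the hub; grid doubling moves the 4th decimal; CERTIFIED by the numpy
job j010409: `κ♯ = 0.85932`, `C_L = 1.1637`, crude `κ_* = 1.42829`, heat-only sharp `0.73056`, attached to the item):
the supremum is attained at `|x| ≈ 11–12` (units of `√(−t)`) and `n = −x/|x|`:
`(|x|+1)I = 0.4507 (x=0), 0.8332 (4), 0.8572 (8), 0.8594 (11–12), 0.8589 (14), 0.8538 (25)`; longitudinal
`n = +x/|x|` stays `≤ 0.679`, transverse `≤ 0.708`.  The CRUDE kernel (max over directions of the full vector,
radial convolution) gives `κ_* = 1.4283 ⇒ C < 0.700` — by accident just short of FELC's `1/√2 = 0.7071`; the sharp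
form has a 65% margin.  Check: `∫₀^∞ k(u)u du = 1/(8π)` for both kernels (`h‴` integrates out).  Caveats: float
quadrature (an interval version is routine: positive smooth integrand); the constant is that of the MAJORANT method,
the true Liouville threshold of the class may be larger; mildness from `−∞` uses the `√(−t)` in the apex bound.

*Refinement — the capped monotone iteration (optimal form of the majorant method; `local/iterate.py`,
`local/iter2.py`, numbers to be re-certified by a numpy job).*  Since `|u| ≤ g` implies `|u| ≤ M(g)` with the
MONOTONE quadratic map `M(g)(t,x) := supₙ ∫∫ λ_max⁺(sym Q⁽ⁿ⁾) g²`, one has `|u| ≤ g_k` for every `k`, where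
`g₀ = CΦ`, `g_{k+1} := min(CΦ, M(g_k))` (all `g_k` self-similar radial profiles by scaling covariance); if
`g_k → 0` pointwise then `u = 0`.  The one-step contraction above is the case `k = 1`.  Iterating the precomputed
kernel on a log grid `ζ ∈ [10⁻², 3·10³]` (56 nodes, 4 output directions): COLLAPSE (`max g_k/(CΦ) < 10⁻⁶`) for
`C = 1.16, 1.30, 1.50` after `7, 9, 22` steps; a non-zero fixed profile of the capped map (method exhausted, no
collapse anywhere) from `C = 1.55` on.  So the majorant method's threshold is `C_maj ≈ 1.5` (`±0.05`; the coarse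
kernel tables of the iteration over-estimate `κ♯` by 1%), and everything said below for `C < 1.16` holds, numerically,
for `C < 1.5`.

*Lean.*  `ApexLiouville`, `scarRigidityAt_of_apexLiouville`, `scarRigidity_iff_above_liouville`,
`noApexTypeIProfile_below_of_apexLiouville`, `bootstrap_eq_zero` are LANDED as
`Theorems/ScarRigidity/Negative/ApexLiouvilleVacuity.lean` (p76085, reviewed: "honest hypothesis-Prop, strictly
stronger than the crux slices, every consumer a named conditional") — importable by planners and leads.

**Consequences.**
1. `ScarRigidityAt C` is VACUOUS for every `C < 1.16` (one-step bound; `C < 1.5` by the capped iteration) (`scarRigidityAt_of_apexLiouville` below, given S1α): no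
   singular apex profile — indeed no nonzero apex-class flow — has such a constant.  The crux's content starts at
   `C ≥ 1.5` at the earliest.
2. Line finite-energy-log-convexity: the regime `2C² < 1` (`C < 0.7071`) of `stub_logConvexityBelowThreshold` (S4)
   contains ONLY `V₁ = V₂ = 0` (classical + decaying pressure ⇒ mild on windows ⇒ ancient mild); S4 is true, its
   log-convexity proof superfluous, and the line's theorem-sized output ("ScarRigidity for `2C² < 1`") is vacuous.
   What is left is S5 = the crux (drefute's costume certificate), now known to be vacuous on `[0.7071, 1.5)` too.
3. Size-based log-convexity cannot pass `2C² = 1` (the self-similar frequency rate `Λ ~ |t|⁻¹`, saturated by the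
   §7 mode), the majorant Liouville method is exhausted at `C ≈ 1.5` (non-zero fixed profile of the capped map):
   the region `C ≳ 1.5` is where a Navier–Stokes-specific lever (the profile equation of `ū`) is indispensable —
   consistent with §7/§9.  From the other side the known non-rigidity mechanism does not come close: within the
   `l = 1` poloidal ansatz `W = A(σ)m + B(σ)(m·y)y` of §7 the optimal critical-potential constant
   `sup (1+σ)σ|γ/κ|` (`γ = β − 2α′` the core defect, `κ = A + σB`; `local/ansatz2.py`) is `≈ 27.5` (§7: `28.4`) and
   its far-field value is pinned at `15` by the cubic tail, an order of magnitude above the Jacobian sizes of a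
   background with `C ≈ 1.5`; the window `1.5 ≲ C ≲ O(10)` is terra incognita for both sides.
4. Positive by-product for the route: the TARGET `NoApexTypeIProfile` restricted to `C < 1.16` holds by the same
   argument.  A Lean proof needs an EXPLICIT Oseen-gradient kernel bound (the tree's `exists_norm_oseenKernel_le`
   is existential) — for FELC's `C < 0.7071` even a fairly crude explicit bound suffices (`κ < √2` needed, `κ♯ =
   0.86`), for `C < 1.16` the quadratic-form refinement is required.
5. The `+√(−t)` in the apex bound is load-bearing for Liouville exactly as `Apex` is for the crux: Landau's
   `−1`-homogeneous steady flows (exact on `ℝ³∖{0}`, arbitrarily small `sup |x||U|`) are excluded only by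
   boundedness at the apex axis for `t < 0`. -/

/-- THE BOOTSTRAP behind every contraction-Liouville theorem: `0 ≤ A`, `A ≤ κA²`, `κA < 1` force `A = 0`.
[folklore] -/
theorem bootstrap_eq_zero {A κ : ℝ} (hA : 0 ≤ A) (hκA : κ * A < 1) (h : A ≤ κ * A ^ 2) : A = 0 := by
  nlinarith [mul_nonneg hA (sub_nonneg.2 hκA.le)]

/-- **APEX LIOUVILLE at threshold `C₀`**: every apex-class flow (suitable weak Navier–Stokes on the slab, weak
spatial gradient, `𝐈 < ∞`, `|u| ≤ C/(|x|+√−t)`) with constant `C < C₀` vanishes a.e. on the slab.  §8: true for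
`C₀ = 1/κ♯ ≈ 1.16` modulo the mild representative (S1α) and the numerically certified kernel constant. -/
def ApexLiouville (C₀ : ℝ) : Prop :=
  ∀ (u : ℝ → ℝ³ → ℝ³) (p : ℝ → ℝ³ → ℝ) (G : ℝ → ℝ³ → ℝ³ →L[ℝ] ℝ³) (C : ℝ), C < C₀ →
    IsSuitableWeakSolutionOn 𝕊 1 0 u p → HasWeakSpatialGradientOn 𝕊 u G →
    typeIBound (Iio (0 : ℝ) ×ˢ univ) u p G < ⊤ → HasTypeIDecay C u →
    uncurry u =ᵐ[volume.restrict (Iio (0 : ℝ) ×ˢ (univ : Set ℝ³))] 0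

/-- A flow vanishing a.e. on the past slab is not backward-singular at the origin (`Q₁(0,0) ⊆` slab). [folklore] -/
theorem not_isBackwardSingularPoint_of_ae_zero {u : ℝ → ℝ³ → ℝ³}
    (h : uncurry u =ᵐ[volume.restrict (Iio (0 : ℝ) ×ˢ (univ : Set ℝ³))] 0) :
    ¬ IsBackwardSingularPoint u 0 := by
  intro hs
  have h1 := hs 1 one_pos
  have hsub : parabolicCylinder 1 (0 : ℝ × ℝ³) ⊆ Iio (0 : ℝ) ×ˢ (univ : Set ℝ³) := by
    intro w hw
    rw [mem_parabolicCylinder] at hw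
    exact mk_mem_prod (by simpa using hw.1.2) (mem_univ _)
  have hae : uncurry u =ᵐ[volume.restrict (parabolicCylinder 1 (0 : ℝ × ℝ³))] 0 :=
    ae_restrict_of_ae_restrict_of_subset hsub h
  rw [eLpNorm_congr_ae hae, eLpNorm_zero] at h1
  exact ENNReal.zero_ne_top h1

/-- **VACUITY BELOW A LIOUVILLE THRESHOLD**: if the apex class is trivial for constants `< C₀`, every slice
`ScarRigidityAt C`, `C < C₀`, holds — vacuously: the first flow of any instance would be backward-singular and
a.e. zero at once.  With §8's `C₀ ≈ 1.16` this covers the whole `2C² < 1` regime of the picked line and more. -/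
theorem scarRigidityAt_of_apexLiouville {C₀ C : ℝ} (h : ApexLiouville C₀) (hC : C < C₀) : ScarRigidityAt C := by
  intro u₁ p₁ G₁ u₂ p₂ G₂ hs₁ hg₁ hI₁ hd₁ _ _ _ _ hsing₁ _ _
  exact absurd hsing₁ (not_isBackwardSingularPoint_of_ae_zero (h u₁ p₁ G₁ C hC hs₁ hg₁ hI₁ hd₁))

/-- The crux splits at any Liouville threshold: below it nothing is to be proved. [folklore] -/
theorem scarRigidity_iff_above_liouville {C₀ : ℝ} (h : ApexLiouville C₀) :
    ScarRigidity ↔ ∀ C : ℝ, C₀ ≤ C → ScarRigidityAt C := by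
  rw [scarRigidity_iff_forall_at]
  refine ⟨fun hall C _ => hall C, fun habove C => ?_⟩
  rcases lt_or_ge C C₀ with hC | hC
  · exact scarRigidityAt_of_apexLiouville h hC
  · exact habove C hC


/-! ## §9 (cycle 4, NEW) Divergence-form couplings: the momentum obstruction is universal for the dipole
mode; the quadrupole mode and the transport structure of the inverse problem -/

/-- **(a) MOMENTUM OBSTRUCTION FOR EVERY DIVERGENCE-FORM COUPLING (paper theorem).**  Let `W, Π₀, ρ` be the §7
mode (`LW = ∇Π₀ + ρ(|y|²)m`, `L = Δ − ½y·∇ − ½`, `∫_{ℝ³} ρ = 4π`, `∮_{S_R} Π₀ n → −(4π/3)m`).  There are NO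
divergence-free fields `U₁, U₂ ∈ C¹` with `Uᵢ = O(1)`, `∇Uᵢ = O(|y|^{−1−ε})` (in particular no pair of Type-I-size
coefficient fields `|Uᵢ| ≲ C⟨y⟩⁻¹`, `|∇Uᵢ| ≲ C⟨y⟩⁻²`, equal or not) and no scalar `Πₜ` with
`LW = ∇·(U₁⊗W + W⊗U₂) + ∇Πₜ` on `ℝ³` (`= (U₁·∇)W + (W·∇)U₂ + ∇Πₜ`, the crux's own linearised wording with
INDEPENDENT coefficients).  PROOF — verbatim §7.11 with `Ū⊗W + W⊗Ū` replaced by `U₁⊗W + W⊗U₂`: the argument used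
only (i) divergence form, so that `∫_{B_R} ∇·(U₁⊗W + W⊗U₂) = ∮_{S_R}[(U₁·n)W + (W·n)U₂] = O(R²·R⁻¹·R⁻³) → 0`,
and (ii) the decay `∇(Πₜ − Π₀) = ρm − ∇·(U₁⊗W+W⊗U₂) = O(|y|⁻⁵)`, which forbids a dipole correction to the pressure
(`Πₜ − Π₀ = c + O(|y|⁻³)`, `∮Πₜ n → ∮Π₀ n`); equating the `B_R`-integrals gives `(8π/3)m = −(4π/3)m`, i.e.
`4πm = 0`. ∎  MEANING: the §7 barrier cannot be upgraded to the crux's linearised statement AS WORDED by keeping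
the dipole-tailed `W`; any divergence-form neutral mode has zero net force `∫(LW − ∇Π) = 0`, i.e. its far field
is quadrupolar or higher — flatness `(−t)^{3/2}|x|⁻⁴`, exactly the first rung of the painted ladder (MCR). -/
theorem divergenceForm_dipole_obstruction_note : True := trivial

/-- **(b) THE QUADRUPOLE MODE AND THE TRANSPORT STRUCTURE (paper; numerics j010164 / j010165 pending).**
`W₂ := ∂_z W₁ = ∇(∂_z²G) − (∂_zΔG)e_z` (`G = ⟨y⟩⁻¹`; smooth, divergence free, axisymmetric poloidal, even under
`z ↦ −z`, `W₂ = O(|y|⁻⁴)`, Stokes stream function `Ψ₂ = −3zr²⟨y⟩⁻⁵`, two counter-rotating vortex rings at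
`(r,z) = (1, ±1/√2)`, ALL meridional streamlines closed; `W₂(0) = 0`).  Using `L∂_z = ∂_z(L + ½)` and
`L∇ = ∇L₀` (`L₀ = Δ − ½y·∇`): `LW₂ = ∇Π₀⁽²⁾ + (∂_z ρ̃)e_z`, `ρ̃ = −L₀ΔG` radial, so the net force and (by
axisymmetry) the net torque of the defect vanish — both Killing obstructions are void.  For axisymmetric poloidal
coefficient fields the curl of `LW₂ = (U₁·∇)W₂ + (W₂·∇)U₂ + ∇Π` is ONE scalar equation
`r[U₁·∇η + W₂·∇η̄₂] = −S`, `η = (curl W₂)_φ/r = −105 z⟨y⟩⁻⁹`, `η̄₂ = (curl U₂)_φ/r`, `S = [(L−1)curl W₂]_φ`: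
U₁ enters ALGEBRAICALLY (advection of the known `η`), U₂ through TRANSPORT of its own `η̄₂` along the closed
streamlines of `W₂`.  Hence: stretch-only (`U₁ = 0`) needs `∮_{Ψ₂ = c} S/(r|W₂|) dℓ = 0` on every streamline —
generically violated; drift-only (`U₂ = 0`) is `{Ψ₁, η} = −S` (Poisson bracket in `(r,z)`), an integration along
the level arcs of `η`, which run from axis to axis — again one condition per arc; with BOTH fields the orbital
conditions are met by `U₁` and `η̄₂` is then integrated and inverted (`E²Ψ₂ = −r²η̄₂`), so independent
coefficients are generically unobstructed; the exact linearisation `U₁ = U₂ = Ū` couples the orbital conditions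
to the elliptic inversion with one free function `F(Ψ_W)` against one condition per streamline — a balanced
Fredholm-type problem with no a-priori obstruction.  NUMERICS SO FAR: a least-squares test over the small
rational basis `Ψ̄ = Σ c_{l,n} ρ^{l+1}⟨ρ⟩^{−l−2n}(1−μ²)P_l′(μ)` (`l ≤ 12` even — the parity forced by `z ↦ −z` —,
`n ≤ 6`; `local/lsq.py` on the hub) is ILL-CONDITIONED and inconclusive: relative residuals plateau at `0.2–0.4`
with exploding coefficients for the control `W₁` and the test `W₂` alike, so it has no discriminating power (the
matching kit jobs were cancelled); a spectral Chebyshev(mapped radius) × Legendre collocation with SVD truncation is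
queued as kit job j011078 and its verdict (residual decay vs plateau against the obstructed control, Type-I size of the
minimiser) is to be folded in here.  The right tool, if that also stalls, is a solver in the action–angle coordinates
of `Ψ₂` (Fourier in the angle along each closed streamline), where the orbital conditions are explicit.  EXPECTED READING: a solvable `W₂` case extends the §7 barrier to every LINEAR method (coefficients = any
divergence-free Type-I-size pair); an obstruction would be a new `ℓ = 2` conservation identity — the missing lever
of MCR's `stub_quadrupoleDefectVanishes`. -/
theorem quadrupole_transport_structure_note : True := trivial

/-- **(c) WHY NO "ESS WITH PRESSURE" LEMMA (recorded to stop re-derivations).**  Backward uniqueness / unique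
continuation for `∂ₜw − Δw + Vw + ∇q = 0`, `div w = 0`, on a HALF-SPACE or EXTERIOR domain fails trivially even
for `V = 0`, bounded `w` and bounded `q`: `w = c(t)∇h₀`, `q = −c′(t)h₀` with `h₀` harmonic in the domain and
singular outside it (e.g. `h₀ = |x + 2e|⁻¹` on `{x·e > 0}`), `c(0) = 0`.  This is the pressure-driven potential
flow of §2 (C)/(D) (`scarRigidity_false_local`, `…_parabolicExterior`); the tree's `ess_backward_uniqueness`
(heat operator, no pressure) is not contradicted.  So the only meaningful negative statements at the potential
level are WHOLE-SPACE ones with regularity across the apex axis — which is what §7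
(`differenceInequalityRigidity_false`, landed as `Negative/NeutralMode.lean`) provides: there the far field is a
zero-scar potential flow but the core is regular, and the non-uniqueness is carried by the critical potential. -/
theorem halfspace_pressure_nonuniqueness_note : True := trivial


/-! ## §10 (cycle 4) Literature re-check — see the module docblock; nothing in print on explicit Liouville
constants in the apex normalisation or on neutral modes of the Stokes–Ornstein–Uhlenbeck system with critical
coefficients (searchd rc75, arXiv 429: degraded; zbMATH/galaxy up). -/

end Summit.NavierStokesRegularity.NavierStokesRegularity.Cruxes.ScarRigidity.Disproof

end
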